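import Literature.Analysis.FluidPDE.FracNSGalerkinLimitField
import Literature.Analysis.FluidPDE.NSHopfGalerkinLimit
import HarnessLib

/-!
# Fractional Navier–Stokes on `T^d`: the weak form of the equations for the limit of a
  fractional Galerkin scheme (proof of the named fact `fracGalerkin_limit`, part 4)

Analysis/FluidPDE. Fourth module of the proof of the named fact
`Literature.Analysis.FluidPDE.fracGalerkin_limit` (`Literature/Analysis/FluidPDE/FracNSGalerkin`;
Colombo–De Lellis–De Rosa 2018, §9, proof of Thm. 1.1: the strong `L²_loc` limit `v` of the
Galerkin approximations "is a Leray solution", i.e. in particular a distributional solution with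
datum in the sense of §1, "`∫₀^∞∫ [(∂ₜ - (-Δ)^α)φ·v + Dφ : v⊗v] = -∫ v̄·φ(·,0)`"), continuing
`FracNSGalerkinLimitField` and following the tree's `α = 1` module `NSHopfGalerkinLimit` (Part 1)
step by step, with the viscous test term `νΔψ` replaced by `-(-Δ)^α ψ`
(`Literature/Analysis/FluidPDE/FracLaplacianSmooth`: convergence, eigenmodes, joint continuity):

* **integration by parts in time at the Galerkin level** (`intervalIntegral_mode_ibp`);
* **linearity of `(-Δ)^α` over finite real combinations of smooth fields** and the
  **Galerkin equations in weak form against truncated test fields** (`galerkin_weak_identity`):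
  `∫₀ᵀ∫ (⟪U n, P_M∂ₜψ⟫ + ⟪U n, (U n·∇)P_Mψ⟫ - ⟪U n, (-Δ)^α P_Mψ⟫) + ∫⟪u₀, P_Mψ(0)⟫ = 0`, `M = N n`;
* **`L¹(0,T)` convergence of the weak-form slice functionals** along the scheme (the generic slice
  estimate `Torus.enorm_sliceFunctional_sub_le` of the `α = 1` development with vanishing forces,
  strong `L²ₜₓ` convergence `FracNSGalerkinLimitField`);
* the **uniform truncation error of `(-Δ)^α ψ`** for smooth space–time test fields
  (`Torus.exists_norm_fracLaplacian_sub_fourierTruncate_le_spaceTime`), the vanishing of the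
  weak-form functional of the approximations, and the **weak form of the limit on `(0, T)`**
  (`IsFracGalerkinScheme.weak_form_limit`).

The dissipative term is written `- 1 * ⟪·, (-Δ)^α ψ⟫` throughout, literally as in
`Torus.IsWeakFracNSSolutionWithData α 1` (viscosity `1`). Theorem-only module.

## References

* M. Colombo, C. De Lellis, L. De Rosa, *Ill-posedness of Leray solutions for the hypodissipative
  Navier–Stokes equations*, Comm. Math. Phys. 362 (2018), §1 (weak formulation), §9.
  [`ColomboDelellisDerosa2018`]
* J. C. Robinson, J. L. Rodrigo, W. Sadowski, *The three-dimensional Navier–Stokes equations*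
  (CUP 2016), Thm. 4.4 Step 4 (pp. 76–77), (4.5), Lemma 4.1 (the `α = 1` template).
  [`RobinsonRodrigoSadowski2016`]
-/

noncomputable section

open MeasureTheory TopologicalSpace Set Function Filter Topology UnitAddTorus
open scoped InnerProductSpace RealInnerProductSpace ENNReal NNReal

namespace Literature.Analysis.FluidPDE

variable {d : Type*} [Fintype d] [DecidableEq d]

/-! ## Tools on `T^d`: linearity and truncation of `(-Δ)^α`, algebra of the weak-form integrand -/

namespace Torus

omit [Fintype d] [DecidableEq d] in
/-- **Pointwise estimate for differences of the fractional weak-form integrand** (inner-product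
algebra plus Young's inequality; the `α = 1` analogue is `abs_weakIntegrand_sub_le`): with
`D = U₁ - U₂`,
`(⟪U₁,p⟫ + ⟪U₁,A U₁⟫ - 1·⟪U₁,L⟫) - (same with U₂) = ⟪D,p⟫ + ⟪D, A U₁⟫ + ⟪U₂, A D⟫ - ⟪D,L⟫`,
each product bounded by `(2λ)⁻¹ a² + (λ/2) b²`. [folklore] -/
theorem abs_fracWeakIntegrand_sub_le {E : Type*} [NormedAddCommGroup E] [InnerProductSpace ℝ E]
    (U₁ U₂ p L : E) (A : E →L[ℝ] E) {C : ℝ} (hC : ∀ w, ‖A w‖ ≤ C * ‖w‖) {lam : ℝ} (hlam : 0 < lam) :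
    |(⟪U₁, p⟫ + ⟪U₁, A U₁⟫ - 1 * ⟪U₁, L⟫) - (⟪U₂, p⟫ + ⟪U₂, A U₂⟫ - 1 * ⟪U₂, L⟫)| ≤
      (2 * lam)⁻¹ * (4 * ‖U₁ - U₂‖ ^ 2) +
        lam / 2 * (‖p‖ ^ 2 + C ^ 2 * ‖U₁‖ ^ 2 + C ^ 2 * ‖U₂‖ ^ 2 + ‖L‖ ^ 2) := by
  have hdiff : (⟪U₁, p⟫ + ⟪U₁, A U₁⟫ - 1 * ⟪U₁, L⟫) - (⟪U₂, p⟫ + ⟪U₂, A U₂⟫ - 1 * ⟪U₂, L⟫) =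
      ⟪U₁ - U₂, p⟫ + (⟪U₁ - U₂, A U₁⟫ + ⟪U₂, A (U₁ - U₂)⟫) - ⟪U₁ - U₂, L⟫ := by
    simp only [inner_sub_left, inner_sub_right, map_sub]
    ring
  rw [hdiff]
  have b1 : |⟪U₁ - U₂, p⟫| ≤ (2 * lam)⁻¹ * ‖U₁ - U₂‖ ^ 2 + lam / 2 * ‖p‖ ^ 2 := by
    refine (abs_real_inner_le_norm _ _).trans ?_
    have := Torus.mul_le_young ‖p‖ ‖U₁ - U₂‖ hlam
    linarith [mul_comm ‖U₁ - U₂‖ ‖p‖]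
  have b2 : |⟪U₁ - U₂, A U₁⟫| ≤ (2 * lam)⁻¹ * ‖U₁ - U₂‖ ^ 2 + lam / 2 * (C ^ 2 * ‖U₁‖ ^ 2) := by
    refine (abs_real_inner_le_norm _ _).trans ?_
    have h1 : ‖U₁ - U₂‖ * ‖A U₁‖ ≤ ‖U₁ - U₂‖ * (C * ‖U₁‖) :=
      mul_le_mul_of_nonneg_left (hC U₁) (norm_nonneg _)
    have h2 := Torus.mul_le_young (C * ‖U₁‖) ‖U₁ - U₂‖ hlam
    nlinarith
  have b3 : |⟪U₂, A (U₁ - U₂)⟫| ≤ (2 * lam)⁻¹ * ‖U₁ - U₂‖ ^ 2 + lam / 2 * (C ^ 2 * ‖U₂‖ ^ 2) := by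
    refine (abs_real_inner_le_norm _ _).trans ?_
    have h1 : ‖U₂‖ * ‖A (U₁ - U₂)‖ ≤ ‖U₂‖ * (C * ‖U₁ - U₂‖) :=
      mul_le_mul_of_nonneg_left (hC _) (norm_nonneg _)
    have h2 := Torus.mul_le_young (C * ‖U₂‖) ‖U₁ - U₂‖ hlam
    nlinarith
  have b4 : |⟪U₁ - U₂, L⟫| ≤ (2 * lam)⁻¹ * ‖U₁ - U₂‖ ^ 2 + lam / 2 * ‖L‖ ^ 2 := by
    refine (abs_real_inner_le_norm _ _).trans ?_
    have := Torus.mul_le_young ‖L‖ ‖U₁ - U₂‖ hlam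
    linarith [mul_comm ‖U₁ - U₂‖ ‖L‖]
  calc |⟪U₁ - U₂, p⟫ + (⟪U₁ - U₂, A U₁⟫ + ⟪U₂, A (U₁ - U₂)⟫) - ⟪U₁ - U₂, L⟫|
      ≤ |⟪U₁ - U₂, p⟫| + (|⟪U₁ - U₂, A U₁⟫| + |⟪U₂, A (U₁ - U₂)⟫|) + |⟪U₁ - U₂, L⟫| :=
        (abs_sub _ _).trans (add_le_add ((abs_add_le _ _).trans (add_le_add le_rfl (abs_add_le _ _))) le_rfl)
    _ ≤ _ := by nlinarith [b1, b2, b3, b4]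

/-- **Integrability of the fractional weak-form integrand** on a slice: for `U ∈ L²(T^d)`, smooth
`b` and continuous `p`, `L`, the function `⟪U, p⟫ + ⟪U, (U·∇)b⟫ - 1·⟪U, L⟫` is integrable
(`|⟪U, (U·∇)b⟫| ≤ C‖U‖²`). [folklore] -/
theorem integrable_fracWeakIntegrand {U : UnitAddTorus d → EuclideanSpace ℝ d}
    (hU : MemLp U 2 volume) {b p L : UnitAddTorus d → EuclideanSpace ℝ d}
    (hb : FunctionSpaces.Torus.IsSmooth b) (hp : Continuous p) (hL : Continuous L) :
    Integrable (fun x => ⟪U x, p x⟫ + ⟪U x, FunctionSpaces.Torus.convect U b x⟫ - 1 * ⟪U x, L x⟫) volume := by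
  have h0 : MemLp (fun (_ : UnitAddTorus d) => (0 : EuclideanSpace ℝ d)) 2 volume := memLp_const 0
  have h := Torus.integrable_weakIntegrand hU h0 hb hp hL (-1)
  refine h.congr (ae_of_all _ fun x => ?_)
  simp only [inner_zero_left, add_zero, neg_one_mul, one_mul, sub_eq_add_neg]

/-- **Slice estimate for the fractional weak-form functional** (the single analytic inequality
behind the passage to the limit; the `α = 1` analogue is `Torus.enorm_sliceFunctional_sub_le`): for
`U₁, U₂ ∈ L²(T^d)`, a smooth test slice `b` with `∑ᵢ ‖∂ᵢ b‖ ≤ C`, and continuous `p`, `L` with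
`‖p‖ ≤ K_p`, `‖L‖ ≤ K_L`, and every `λ > 0`,
`‖Φ(U₁) - Φ(U₂)‖ₑ ≤ (2λ)⁻¹ · 4‖U₁-U₂‖² + (λ/2)(K_p² + K_L² + C²(‖U₁‖² + ‖U₂‖²))`
where `Φ(U) = ∫ (⟪U,p⟫ + ⟪U,(U·∇)b⟫ - 1·⟪U,L⟫)` and the norms on the right are `L²` norms. [folklore] -/
theorem enorm_fracSliceFunctional_sub_le {U₁ U₂ : UnitAddTorus d → EuclideanSpace ℝ d}
    (hU₁ : MemLp U₁ 2 volume) (hU₂ : MemLp U₂ 2 volume) {b p L : UnitAddTorus d → EuclideanSpace ℝ d}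
    (hb : FunctionSpaces.Torus.IsSmooth b) (hp : Continuous p) (hL : Continuous L) {C Kp KL : ℝ}
    (hC : ∀ x, ∑ i, ‖FunctionSpaces.Torus.partialDeriv i b x‖ ≤ C) (hKp : ∀ x, ‖p x‖ ≤ Kp) (hKL : ∀ x, ‖L x‖ ≤ KL)
    {lam : ℝ} (hlam : 0 < lam) :
    ‖(∫ x, (⟪U₁ x, p x⟫ + ⟪U₁ x, FunctionSpaces.Torus.convect U₁ b x⟫ - 1 * ⟪U₁ x, L x⟫)) -
        ∫ x, (⟪U₂ x, p x⟫ + ⟪U₂ x, FunctionSpaces.Torus.convect U₂ b x⟫ - 1 * ⟪U₂ x, L x⟫)‖ₑ ≤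
      ENNReal.ofReal (2 * lam)⁻¹ * (4 * ∫⁻ x, ‖U₁ x - U₂ x‖ₑ ^ 2) +
        ENNReal.ofReal (lam / 2) * (ENNReal.ofReal (Kp ^ 2 + KL ^ 2) +
          ENNReal.ofReal (C ^ 2) * ((∫⁻ x, ‖U₁ x‖ₑ ^ 2) + ∫⁻ x, ‖U₂ x‖ₑ ^ 2)) := by
  have i1 := integrable_fracWeakIntegrand hU₁ hb hp hL
  have i2 := integrable_fracWeakIntegrand hU₂ hb hp hL
  rw [← integral_sub i1 i2]
  refine (enorm_integral_le_lintegral_enorm _).trans ?_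
  have hA : ∀ x w, ‖FunctionSpaces.Torus.fderiv b x w‖ ≤ C * ‖w‖ := by
    intro x w
    calc ‖FunctionSpaces.Torus.fderiv b x w‖ ≤ ‖w‖ * ∑ i, ‖FunctionSpaces.Torus.partialDeriv i b x‖ :=
          FunctionSpaces.Torus.norm_fderiv_apply_le (hb.isContDiff (by simp)) x w
      _ ≤ ‖w‖ * C := mul_le_mul_of_nonneg_left (hC x) (norm_nonneg _)
      _ = C * ‖w‖ := mul_comm _ _
  have hpt : ∀ x, ‖(⟪U₁ x, p x⟫ + ⟪U₁ x, FunctionSpaces.Torus.convect U₁ b x⟫ - 1 * ⟪U₁ x, L x⟫) -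
      (⟪U₂ x, p x⟫ + ⟪U₂ x, FunctionSpaces.Torus.convect U₂ b x⟫ - 1 * ⟪U₂ x, L x⟫)‖ₑ ≤
      ENNReal.ofReal (2 * lam)⁻¹ * (4 * ‖U₁ x - U₂ x‖ₑ ^ 2) +
        ENNReal.ofReal (lam / 2) * (ENNReal.ofReal (Kp ^ 2 + KL ^ 2) +
          ENNReal.ofReal (C ^ 2) * (‖U₁ x‖ₑ ^ 2 + ‖U₂ x‖ₑ ^ 2)) := by
    intro x
    have h := abs_fracWeakIntegrand_sub_le (U₁ x) (U₂ x) (p x) (L x) (FunctionSpaces.Torus.fderiv b x) (hA x) hlam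
    rw [Real.enorm_eq_ofReal_abs]
    refine (ENNReal.ofReal_le_ofReal h).trans ?_
    have hl0 : 0 ≤ (2 * lam)⁻¹ := by positivity
    have hl1 : 0 ≤ lam / 2 := by positivity
    rw [ENNReal.ofReal_add (by positivity) (by positivity), ENNReal.ofReal_mul hl0, ENNReal.ofReal_mul hl1,
      ENNReal.ofReal_mul (by norm_num : (0 : ℝ) ≤ 4), ENNReal.ofReal_ofNat, ENNReal.ofReal_norm_sq]
    refine add_le_add le_rfl (mul_le_mul' le_rfl ?_)
    have hsplit : ‖p x‖ ^ 2 + C ^ 2 * ‖U₁ x‖ ^ 2 + C ^ 2 * ‖U₂ x‖ ^ 2 + ‖L x‖ ^ 2 =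
        (‖p x‖ ^ 2 + ‖L x‖ ^ 2) + C ^ 2 * (‖U₁ x‖ ^ 2 + ‖U₂ x‖ ^ 2) := by ring
    rw [hsplit, ENNReal.ofReal_add (by positivity) (by positivity), ENNReal.ofReal_mul (sq_nonneg C)]
    have hU12 : ENNReal.ofReal (‖U₁ x‖ ^ 2 + ‖U₂ x‖ ^ 2) = ‖U₁ x‖ₑ ^ 2 + ‖U₂ x‖ₑ ^ 2 := by
      rw [ENNReal.ofReal_add (by positivity) (by positivity), ENNReal.ofReal_norm_sq, ENNReal.ofReal_norm_sq]
    rw [hU12]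
    refine add_le_add (ENNReal.ofReal_le_ofReal ?_) le_rfl
    have e1 : ‖p x‖ ^ 2 ≤ Kp ^ 2 := pow_le_pow_left₀ (norm_nonneg _) (hKp x) 2
    have e2 : ‖L x‖ ^ 2 ≤ KL ^ 2 := pow_le_pow_left₀ (norm_nonneg _) (hKL x) 2
    linarith
  refine (lintegral_mono fun x => hpt x).trans (le_of_eq ?_)
  have m1 : AEMeasurable (fun x => ‖U₁ x - U₂ x‖ₑ ^ 2) volume := (hU₁.1.sub hU₂.1).enorm.pow_const 2
  have m3 : AEMeasurable (fun x => ‖U₁ x‖ₑ ^ 2) volume := hU₁.1.enorm.pow_const 2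
  have m4 : AEMeasurable (fun x => ‖U₂ x‖ₑ ^ 2) volume := hU₂.1.enorm.pow_const 2
  have m4' : AEMeasurable (fun x => 4 * ‖U₁ x - U₂ x‖ₑ ^ 2) volume := m1.const_mul _
  have mA : AEMeasurable (fun x => ENNReal.ofReal (2 * lam)⁻¹ * (4 * ‖U₁ x - U₂ x‖ₑ ^ 2)) volume := m4'.const_mul _
  rw [lintegral_add_left' mA, lintegral_const_mul'' _ m4', lintegral_const_mul'' _ m1,
    lintegral_const_mul' _ _ ENNReal.ofReal_ne_top,
    lintegral_add_left' aemeasurable_const, lintegral_const, measure_univ, mul_one,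
    lintegral_const_mul' _ _ ENNReal.ofReal_ne_top, lintegral_add_left' m3]

omit [Fintype d] [DecidableEq d] in
/-- Pointwise bound for the truncation error of the fractional weak-form integrand: with
`‖dp‖ ≤ e₁`, `‖dL‖ ≤ e₂`, `‖dc‖ ≤ ‖U‖ e₃` (all `eᵢ ≥ 0`),
`|⟪U,dp⟫ + ⟪U,dc⟫ - 1·⟪U,dL⟫| ≤ (e₁/2 + e₂/2 + e₃)‖U‖² + (e₁/2 + e₂/2)` (`r e ≤ ((r² + 1)/2) e`). [folklore] -/
theorem abs_fracWeakIntegrand_trunc_le {E : Type*} [NormedAddCommGroup E] [InnerProductSpace ℝ E]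
    (U' dp dc dL : E) {e₁ e₂ e₃ : ℝ} (he₁ : 0 ≤ e₁) (he₂ : 0 ≤ e₂)
    (hdp : ‖dp‖ ≤ e₁) (hdL : ‖dL‖ ≤ e₂) (hdc : ‖dc‖ ≤ ‖U'‖ * e₃) :
    |⟪U', dp⟫ + ⟪U', dc⟫ - 1 * ⟪U', dL⟫| ≤ (e₁ / 2 + e₂ / 2 + e₃) * ‖U'‖ ^ 2 + (e₁ / 2 + e₂ / 2) := by
  have hU0 := norm_nonneg U'
  have b1 : |⟪U', dp⟫| ≤ ‖U'‖ * e₁ := (abs_real_inner_le_norm _ _).trans (mul_le_mul_of_nonneg_left hdp hU0)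
  have b2 : |⟪U', dc⟫| ≤ ‖U'‖ ^ 2 * e₃ := by
    refine (abs_real_inner_le_norm _ _).trans ?_
    calc ‖U'‖ * ‖dc‖ ≤ ‖U'‖ * (‖U'‖ * e₃) := mul_le_mul_of_nonneg_left hdc hU0
      _ = ‖U'‖ ^ 2 * e₃ := by ring
  have b3 : |1 * ⟪U', dL⟫| ≤ ‖U'‖ * e₂ := by
    rw [one_mul]
    exact (abs_real_inner_le_norm _ _).trans (mul_le_mul_of_nonneg_left hdL hU0)
  have hU1 : ‖U'‖ ≤ (‖U'‖ ^ 2 + 1) / 2 := by nlinarith [sq_nonneg (‖U'‖ - 1)]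
  have a1 := mul_le_mul_of_nonneg_right hU1 he₁
  have a2 := mul_le_mul_of_nonneg_right hU1 he₂
  calc |⟪U', dp⟫ + ⟪U', dc⟫ - 1 * ⟪U', dL⟫|
      ≤ |⟪U', dp⟫| + |⟪U', dc⟫| + |1 * ⟪U', dL⟫| :=
        (abs_sub _ _).trans (add_le_add (abs_add_le _ _) le_rfl)
    _ ≤ ‖U'‖ * e₁ + ‖U'‖ ^ 2 * e₃ + ‖U'‖ * e₂ := by linarith
    _ ≤ (‖U'‖ ^ 2 + 1) / 2 * e₁ + ‖U'‖ ^ 2 * e₃ + (‖U'‖ ^ 2 + 1) / 2 * e₂ := by linarith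
    _ = _ := by ring

/-- **`(-Δ)^α` is linear over finite real combinations of smooth fields**:
`(-Δ)^θ (∑ᵢ cᵢ aᵢ) = ∑ᵢ cᵢ (-Δ)^θ aᵢ` pointwise (`θ ≥ 0`; the defining series converge,
`Torus.hasSum_fracLaplacian`, and the Fourier coefficients are linear). [folklore] -/
theorem fracLaplacian_finset_sum_smul {θ : ℝ} (hθ : 0 ≤ θ) {ι : Type*} (s : Finset ι) (c : ι → ℝ)
    {a : ι → UnitAddTorus d → EuclideanSpace ℝ d} (ha : ∀ i, FunctionSpaces.Torus.IsSmooth (a i))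
    (x : UnitAddTorus d) :
    fracLaplacian θ (fun y => ∑ i ∈ s, c i • a i y) x = ∑ i ∈ s, c i • fracLaplacian θ (a i) x := by
  classical
  -- Fourier coefficients of the combination
  have hcoef : ∀ k, mFourierCoeff (FunctionSpaces.EuclideanSpace.complexify ∘ fun y => ∑ i ∈ s, c i • a i y) k =
      ∑ i ∈ s, (c i : ℂ) • mFourierCoeff (FunctionSpaces.EuclideanSpace.complexify ∘ a i) k := by
    intro k
    have h1 : (FunctionSpaces.EuclideanSpace.complexify ∘ fun y => ∑ i ∈ s, c i • a i y) =
        fun y => ∑ i ∈ s, ((c i : ℂ) • (FunctionSpaces.EuclideanSpace.complexify ∘ a i)) y := by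
      funext y
      simp only [comp_apply, map_sum, Pi.smul_apply, LinearIsometry.map_smul]
      refine Finset.sum_congr rfl fun i _ => ?_
      exact RCLike.real_smul_eq_coe_smul (K := ℂ) (c i) _
    rw [h1, FunctionSpaces.Torus.mFourierCoeff_finset_sum s (fun i _ =>
      (FunctionSpaces.Torus.integrable_complexify_comp (ha i).continuous.integrable_unitAddTorus).smul (c i : ℂ))]
    exact Finset.sum_congr rfl fun i _ => FunctionSpaces.Torus.mFourierCoeff_const_smul _ _ _
  -- the defining series of the combination, termwise
  have hsum : HasSum (fun k : d → ℤ => ∑ i ∈ s, c i • FunctionSpaces.EuclideanSpace.realPart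
      (fracSymbol θ k • (mFourier k x • mFourierCoeff (FunctionSpaces.EuclideanSpace.complexify ∘ a i) k)))
      (∑ i ∈ s, c i • fracLaplacian θ (a i) x) :=
    hasSum_sum fun i _ => (hasSum_fracLaplacian hθ (ha i) x).const_smul (c i)
  have hf := hasSum_fracLaplacian hθ (isSmooth_finset_sum_smul s c ha) x
  have heq : (fun k : d → ℤ => FunctionSpaces.EuclideanSpace.realPart (fracSymbol θ k • (mFourier k x •
      mFourierCoeff (FunctionSpaces.EuclideanSpace.complexify ∘ fun y => ∑ i ∈ s, c i • a i y) k))) =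
      fun k => ∑ i ∈ s, c i • FunctionSpaces.EuclideanSpace.realPart
        (fracSymbol θ k • (mFourier k x • mFourierCoeff (FunctionSpaces.EuclideanSpace.complexify ∘ a i) k)) := by
    funext k
    rw [hcoef k, Finset.smul_sum, Finset.smul_sum, map_sum]
    refine Finset.sum_congr rfl fun i _ => ?_
    rw [smul_comm (mFourier k x) (c i : ℂ), smul_comm (fracSymbol θ k) (c i : ℂ), realPart_coe_smul]
  rw [heq] at hf
  exact hf.unique hsum

/-- **`(-Δ)^α` of a Fourier truncation** is the finite sum of the weighted modes:
`(-Δ)^θ (P_N a)(x) = ∑_{|k|≤N} Re ((4π²|k|²)^θ e_k(x) â(k))` for continuous `a`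
(`Torus.fracLaplacian_realTrigPoly` on the symmetric ball with the conjugate-symmetric
coefficients of the real field `a`). [folklore] -/
theorem fracLaplacian_fourierTruncate_apply (θ : ℝ) {a : UnitAddTorus d → EuclideanSpace ℝ d}
    (ha : Continuous a) (N : ℕ) (x : UnitAddTorus d) :
    fracLaplacian θ (fun y => FunctionSpaces.Torus.fourierTruncate N a y) x =
      ∑ k ∈ FunctionSpaces.Torus.freqBall N, FunctionSpaces.EuclideanSpace.realPart
        (fracSymbol θ k • (mFourier k x • mFourierCoeff (FunctionSpaces.EuclideanSpace.complexify ∘ a) k)) := by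
  rw [show (fun y => FunctionSpaces.Torus.fourierTruncate N a y) = FunctionSpaces.Torus.fourierTruncate N a from rfl,
    FunctionSpaces.Torus.fourierTruncate_eq,
    fracLaplacian_realTrigPoly FunctionSpaces.Torus.neg_mem_freqBall_of_mem
      (FunctionSpaces.Torus.isConjSymm_mFourierCoeff ha.integrable_unitAddTorus) θ x,
    FunctionSpaces.Torus.realTrigPoly_apply_eq_sum]
  refine Finset.sum_congr rfl fun k _ => ?_
  rw [fracSymbol_smul_mFourier_smul]

/-- As a real trigonometric polynomial: `(-Δ)^θ (P_N a) = realTrigPoly (ball N) (σ_θ • â)`. [folklore] -/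
theorem fracLaplacian_fourierTruncate_eq_realTrigPoly (θ : ℝ) {a : UnitAddTorus d → EuclideanSpace ℝ d}
    (ha : Continuous a) (N : ℕ) (x : UnitAddTorus d) :
    fracLaplacian θ (fun y => FunctionSpaces.Torus.fourierTruncate N a y) x =
      FunctionSpaces.Torus.realTrigPoly (FunctionSpaces.Torus.freqBall N)
        (fun k => ((fracSymbol θ k : ℝ) : ℂ) • mFourierCoeff (FunctionSpaces.EuclideanSpace.complexify ∘ a) k) x := by
  rw [fracLaplacian_fourierTruncate_apply θ ha N x, FunctionSpaces.Torus.realTrigPoly_apply_eq_sum]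
  refine Finset.sum_congr rfl fun k _ => ?_
  rw [fracSymbol_smul_mFourier_smul]

/-- **Uniform truncation error of `(-Δ)^α ψ` for smooth space–time test data**: for `ψ` smooth on
`ℝ × T^d`, `θ ≥ 0` and every `T` there is `K ≥ 0` with
`‖(-Δ)^θ ψ(t)(x) - (-Δ)^θ (P_N ψ(t))(x)‖ ≤ K ∑_{k ∉ ball N} ((1 + |k|²)^{#d})⁻¹` for all `N`,
`t ∈ [0, T]`, `x` (the tail of the defining series, dominated by the uniform weighted decay
`Torus.exists_fracSymbol_mul_norm_le_spaceTime`). [folklore] -/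
theorem exists_norm_fracLaplacian_sub_fourierTruncate_le_spaceTime {θ : ℝ} (hθ : 0 ≤ θ)
    {ψ : ℝ → UnitAddTorus d → EuclideanSpace ℝ d} (hψ : FunctionSpaces.Torus.IsSmoothSpaceTimeOn univ ψ) (T : ℝ) :
    ∃ K : ℝ, 0 ≤ K ∧ ∀ (N : ℕ), ∀ t ∈ Icc 0 T, ∀ x,
      ‖fracLaplacian θ (ψ t) x - fracLaplacian θ (fun y => FunctionSpaces.Torus.fourierTruncate N (ψ t) y) x‖ ≤
        K * ∑' k : {k // k ∉ FunctionSpaces.Torus.freqBall (d := d) N},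
          ((1 + FunctionSpaces.Torus.freqNormSq (k : d → ℤ)) ^ Fintype.card d)⁻¹ := by
  obtain ⟨M, hM0, hM⟩ := exists_fracSymbol_mul_norm_le_spaceTime hθ hψ (isCompact_Icc (a := (0 : ℝ)) (b := T))
  refine ⟨M, hM0, fun N t ht x => ?_⟩
  have hs : FunctionSpaces.Torus.IsSmooth (ψ t) := hψ.isSmooth_slice (mem_univ t)
  set F : (d → ℤ) → EuclideanSpace ℝ d := fun k => FunctionSpaces.EuclideanSpace.realPart
    (fracSymbol θ k • (mFourier k x • mFourierCoeff (FunctionSpaces.EuclideanSpace.complexify ∘ ψ t) k)) with hF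
  have h := hasSum_fracLaplacian hθ hs x
  have hsplit := h.summable.sum_add_tsum_compl (s := FunctionSpaces.Torus.freqBall N)
  rw [h.tsum_eq] at hsplit
  have htrunc : fracLaplacian θ (fun y => FunctionSpaces.Torus.fourierTruncate N (ψ t) y) x =
      ∑ k ∈ FunctionSpaces.Torus.freqBall N, F k := fracLaplacian_fourierTruncate_apply θ hs.continuous N x
  have hdiff : fracLaplacian θ (ψ t) x - fracLaplacian θ (fun y => FunctionSpaces.Torus.fourierTruncate N (ψ t) y) x =
      ∑' k : ↥((FunctionSpaces.Torus.freqBall N : Finset (d → ℤ)) : Set (d → ℤ))ᶜ, F k := by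
    rw [htrunc, ← hsplit, add_sub_cancel_left]
  rw [hdiff]
  have hb : ∀ k : d → ℤ, ‖F k‖ ≤ M * ((1 + FunctionSpaces.Torus.freqNormSq k) ^ Fintype.card d)⁻¹ := fun k =>
    (norm_realPart_fracSymbol_smul_le θ k x _).trans (hM t ht k)
  have hns : Summable fun k : ↥((FunctionSpaces.Torus.freqBall N : Finset (d → ℤ)) : Set (d → ℤ))ᶜ =>
      M * ((1 + FunctionSpaces.Torus.freqNormSq (k : d → ℤ)) ^ Fintype.card d)⁻¹ :=
    (FunctionSpaces.Torus.summable_inv_one_add_freqNormSq_pow_card.mul_left M).subtype _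
  have hns' : Summable fun k : ↥((FunctionSpaces.Torus.freqBall N : Finset (d → ℤ)) : Set (d → ℤ))ᶜ => ‖F k‖ :=
    Summable.of_nonneg_of_le (fun k => norm_nonneg _) (fun k => hb k) hns
  calc ‖∑' k : ↥((FunctionSpaces.Torus.freqBall N : Finset (d → ℤ)) : Set (d → ℤ))ᶜ, F k‖
      ≤ ∑' k : ↥((FunctionSpaces.Torus.freqBall N : Finset (d → ℤ)) : Set (d → ℤ))ᶜ, ‖F k‖ := norm_tsum_le_tsum_norm hns'
    _ ≤ ∑' k : ↥((FunctionSpaces.Torus.freqBall N : Finset (d → ℤ)) : Set (d → ℤ))ᶜ,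
          M * ((1 + FunctionSpaces.Torus.freqNormSq (k : d → ℤ)) ^ Fintype.card d)⁻¹ :=
        Summable.tsum_le_tsum (fun k => hb k) hns' hns
    _ = M * ∑' k : {k // k ∉ FunctionSpaces.Torus.freqBall (d := d) N},
          ((1 + FunctionSpaces.Torus.freqNormSq (k : d → ℤ)) ^ Fintype.card d)⁻¹ := by
        rw [tsum_mul_left]
        rfl

omit [DecidableEq d] in
/-- The space–time lift of a slicewise real trigonometric polynomial with coefficients
continuous in time is continuous. [folklore] -/
theorem continuous_stLift_realTrigPoly {c : ℝ → (d → ℤ) → EuclideanSpace ℂ d}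
    (hc : ∀ k, Continuous fun t => c t k) (S : Finset (d → ℤ)) :
    Continuous (FunctionSpaces.Torus.stLift fun t x => FunctionSpaces.Torus.realTrigPoly S (c t) x) := by
  have h : (FunctionSpaces.Torus.stLift fun t x => FunctionSpaces.Torus.realTrigPoly S (c t) x) = fun q =>
      ∑ k ∈ S, FunctionSpaces.EuclideanSpace.realPart (mFourier k (FunctionSpaces.Torus.proj q.2) • c q.1 k) := by
    funext q
    obtain ⟨t, y⟩ := q
    rw [FunctionSpaces.Torus.stLift_apply, FunctionSpaces.Torus.realTrigPoly_apply_eq_sum]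
  rw [h]
  refine continuous_finsetSum _ fun k _ => FunctionSpaces.EuclideanSpace.realPart.continuous.comp ?_
  exact (((mFourier k).continuous.comp (FunctionSpaces.Torus.continuous_proj.comp continuous_snd))).smul
    ((hc k).comp continuous_fst)

end Torus

section Scheme

variable {α : ℝ} {u₀ : UnitAddTorus d → EuclideanSpace ℝ d} {N : ℕ → ℕ}
  {U : ℕ → ℝ → UnitAddTorus d → EuclideanSpace ℝ d}
  {u : ℝ → UnitAddTorus d → EuclideanSpace ℝ d}

/-! ## Integration by parts in time at the Galerkin level -/

section IBP

/-- The tested fractional Galerkin right-hand side `t ↦ ∫(⟪U n,(U n·∇)a⟫ - ⟪U n, (-Δ)^α a⟫)` is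
continuous on `[0, ∞)` for a smooth field `a` (`α ≥ 0`). [folklore] -/
theorem IsFracGalerkinScheme.continuousOn_galerkin_rhs (hS : IsFracGalerkinScheme α u₀ N U)
    (hα : 0 ≤ α) (n : ℕ) {a : UnitAddTorus d → EuclideanSpace ℝ d} (ha : FunctionSpaces.Torus.IsSmooth a) :
    ContinuousOn (fun t => ∫ x, (⟪U n t x, FunctionSpaces.Torus.convect (U n t) a x⟫ -
      ⟪U n t x, Torus.fracLaplacian α a x⟫)) (Set.Ici 0) := by
  have hU := hS.continuousOn n
  have hconv : ContinuousOn (FunctionSpaces.Torus.stLift fun t x => FunctionSpaces.Torus.convect (U n t) a x) (Set.Ici 0 ×ˢ Set.univ) := by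
    have h : (FunctionSpaces.Torus.stLift fun t x => FunctionSpaces.Torus.convect (U n t) a x) =
        fun p => ∑ i, (FunctionSpaces.Torus.stLift (U n) p) i • FunctionSpaces.Torus.partialDeriv i a (FunctionSpaces.Torus.proj p.2) := by
      funext p
      exact FunctionSpaces.Torus.fderiv_apply_eq_sum_partialDeriv (ha.isContDiff (by simp)) _ _
    rw [h]
    refine continuousOn_finsetSum _ fun i _ => ?_
    have hc1 : ContinuousOn (fun p : ℝ × EuclideanSpace ℝ d => (FunctionSpaces.Torus.stLift (U n) p) i)
        (Set.Ici 0 ×ˢ Set.univ) :=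
      (EuclideanSpace.proj (𝕜 := ℝ) i).continuous.comp_continuousOn hU
    have hc2 : ContinuousOn (fun p : ℝ × EuclideanSpace ℝ d => FunctionSpaces.Torus.partialDeriv i a (FunctionSpaces.Torus.proj p.2))
        (Set.Ici 0 ×ˢ Set.univ) :=
      ((ha.partialDeriv i).continuous.comp (FunctionSpaces.Torus.continuous_proj.comp continuous_snd)).continuousOn
    exact hc1.smul hc2
  have hlap : ContinuousOn (FunctionSpaces.Torus.stLift fun (_ : ℝ) x => Torus.fracLaplacian α a x) (Set.Ici 0 ×ˢ Set.univ) :=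
    ((Torus.continuous_fracLaplacian hα ha).comp (FunctionSpaces.Torus.continuous_proj.comp continuous_snd)).continuousOn
  have h1 := FunctionSpaces.Torus.continuousOn_integral_inner_of_continuousOn_stLift hU hconv
  have h2 := FunctionSpaces.Torus.continuousOn_integral_inner_of_continuousOn_stLift hU hlap
  refine (h1.sub h2).congr fun t ht => ?_
  have ht0 : 0 ≤ t := ht
  have hcU : Continuous (U n t) := hS.continuous_slice n ht0
  have i1 : Integrable (fun x => ⟪U n t x, FunctionSpaces.Torus.convect (U n t) a x⟫) volume := by
    have h : (fun x => FunctionSpaces.Torus.convect (U n t) a x) =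
        fun x => ∑ i, (U n t x) i • FunctionSpaces.Torus.partialDeriv i a x := by
      funext x; exact FunctionSpaces.Torus.fderiv_apply_eq_sum_partialDeriv (ha.isContDiff (by simp)) _ _
    have hcc : Continuous (fun x => FunctionSpaces.Torus.convect (U n t) a x) := by
      rw [h]
      exact continuous_finsetSum _ fun i _ =>
        (((EuclideanSpace.proj (𝕜 := ℝ) i).continuous.comp hcU).smul (ha.partialDeriv i).continuous)
    exact (hcU.inner hcc).integrable_unitAddTorus
  have i2 : Integrable (fun x => ⟪U n t x, Torus.fracLaplacian α a x⟫) volume :=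
    (hcU.inner (Torus.continuous_fracLaplacian hα ha)).integrable_unitAddTorus
  simp only [Pi.sub_apply]
  exact integral_sub i1 i2

/-- The tested Galerkin pairing `t ↦ ∫⟪U n t, a⟫` has the tested right-hand side as derivative at
every `t > 0` (FTC for the clause `galerkin`, whose right-hand side is continuous). [folklore] -/
theorem IsFracGalerkinScheme.hasDerivAt_galerkin_pairing (hS : IsFracGalerkinScheme α u₀ N U)
    (hα : 0 ≤ α) (n : ℕ) {a : UnitAddTorus d → EuclideanSpace ℝ d} (ha : IsGalerkinMode (N n) a) {t : ℝ}
    (ht : 0 < t) :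
    HasDerivAt (fun s => ∫ x, ⟪U n s x, a x⟫)
      (∫ x, (⟪U n t x, FunctionSpaces.Torus.convect (U n t) a x⟫ - ⟪U n t x, Torus.fracLaplacian α a x⟫)) t := by
  set h : ℝ → ℝ := fun τ => ∫ x, (⟪U n τ x, FunctionSpaces.Torus.convect (U n τ) a x⟫ -
    ⟪U n τ x, Torus.fracLaplacian α a x⟫) with hh
  have hcont : ContinuousOn h (Set.Ici 0) := hS.continuousOn_galerkin_rhs hα n ha.isSmooth
  have hcontI : ContinuousOn h (Set.Ioi 0) := hcont.mono Set.Ioi_subset_Ici_self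
  have hprim : HasDerivAt (fun s => ∫ τ in (0 : ℝ)..s, h τ) (h t) t := by
    refine intervalIntegral.integral_hasDerivAt_right ?_ ?_ ?_
    · exact (hcont.mono Icc_subset_Ici_self).intervalIntegrable_of_Icc ht.le
    · exact hcontI.stronglyMeasurableAtFilter isOpen_Ioi t ht
    · exact hcontI.continuousAt (Ioi_mem_nhds ht)
  have heq : (fun s => ∫ x, ⟪U n s x, a x⟫) =ᶠ[𝓝 t]
      fun s => (∫ x, ⟪U n 0 x, a x⟫) + ∫ τ in (0 : ℝ)..s, h τ := by
    filter_upwards [Ioi_mem_nhds ht] with s hs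
    have := hS.galerkin n a ha 0 s le_rfl (le_of_lt hs)
    simp only [hh]
    linarith
  exact (hprim.const_add _).congr_of_eventuallyEq heq

/-- **Integration by parts in time at the Galerkin level** (CDLDR 2018, §9 / RRS 2016, Thm. 4.4
Step 4, (4.5) tested against `λ(t) a`): for a Galerkin mode `a` of order `N n`, a scalar `λ` with
continuous derivative `λ'` and `λ(T) = 0`,
`∫₀ᵀ (λ' ⟪U n, a⟫ + λ (⟪U n, (U n·∇)a⟫ - ⟪U n, (-Δ)^α a⟫)) dt = -λ(0) ∫⟪u₀, a⟫`. [folklore] -/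
theorem IsFracGalerkinScheme.intervalIntegral_mode_ibp (hS : IsFracGalerkinScheme α u₀ N U)
    (hα : 0 ≤ α) (n : ℕ) {a : UnitAddTorus d → EuclideanSpace ℝ d} (ha : IsGalerkinMode (N n) a)
    {lam lam' : ℝ → ℝ} (hlam : ∀ t, HasDerivAt lam (lam' t) t) (hlam' : Continuous lam')
    {T : ℝ} (hT : 0 < T) (hlamT : lam T = 0) :
    ∫ t in (0 : ℝ)..T, (lam' t * (∫ x, ⟪U n t x, a x⟫) +
        lam t * ∫ x, (⟪U n t x, FunctionSpaces.Torus.convect (U n t) a x⟫ - ⟪U n t x, Torus.fracLaplacian α a x⟫)) =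
      -(lam 0 * ∫ x, ⟪u₀ x, a x⟫) := by
  have hcst : ContinuousOn (FunctionSpaces.Torus.stLift fun (_ : ℝ) x => a x) (Set.Ici 0 ×ˢ Set.univ) :=
    (ha.isSmooth.continuous.comp (FunctionSpaces.Torus.continuous_proj.comp continuous_snd)).continuousOn
  have hG : ContinuousOn (fun t => ∫ x, ⟪U n t x, a x⟫) (Icc 0 T) :=
    (FunctionSpaces.Torus.continuousOn_integral_inner_of_continuousOn_stLift (hS.continuousOn n) hcst).mono
      Icc_subset_Ici_self
  have hh : ContinuousOn (fun t => ∫ x, (⟪U n t x, FunctionSpaces.Torus.convect (U n t) a x⟫ -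
      ⟪U n t x, Torus.fracLaplacian α a x⟫)) (Icc 0 T) :=
    (hS.continuousOn_galerkin_rhs hα n ha.isSmooth).mono Icc_subset_Ici_self
  have hlamc : Continuous lam := continuous_iff_continuousAt.2 fun t => (hlam t).continuousAt
  have h := intervalIntegral.integral_eq_sub_of_hasDeriv_right_of_le hT.le
    (f := fun t => lam t * ∫ x, ⟪U n t x, a x⟫)
    (f' := fun t => lam' t * (∫ x, ⟪U n t x, a x⟫) + lam t * ∫ x, (⟪U n t x, FunctionSpaces.Torus.convect (U n t) a x⟫ -
      ⟪U n t x, Torus.fracLaplacian α a x⟫))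
    (hlamc.continuousOn.mul hG) (fun t ht => ?_) ?_
  · rw [h, hlamT, zero_mul, zero_sub, hS.initial_inner n a ha]
  · exact ((hlam t).mul (hS.hasDerivAt_galerkin_pairing hα n ha ht.1)).hasDerivWithinAt
  · exact ((hlam'.continuousOn.mul hG).add (hlamc.continuousOn.mul hh)).intervalIntegrable_of_Icc hT.le

end IBP

/-! ## The Galerkin equations in weak form against truncated test fields -/

section GalerkinWeak

/-- **The fractional Galerkin equations in weak form against truncated test fields**
(CDLDR 2018, §9: (NS_reg) tested against `P_K φ`; RRS 2016, Thm. 4.4 Step 4, (4.5) tested against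
`P_n ψ` for `α = 1`): for every divergence-free space–time test field `ψ` on `[0, T)` and every
`n`, with `M = N n` and `α ≥ 0`,
`∫₀ᵀ ∫ (⟪U n, P_M ∂ₜψ⟫ + ⟪U n, (U n·∇)P_M ψ⟫ - ⟪U n, (-Δ)^α P_M ψ⟫) + ∫ ⟪u₀, P_M ψ(0)⟫ = 0`.
Proof: expand `P_M ψ(t) = ∑ᵢ λᵢ(t) aᵢ` along transversal frames (`Torus.fourierTruncate_eq_sum_frame`),
use the linearity of `(U·∇)` and `(-Δ)^α` over the finite combination, and sum the one-mode
identities `intervalIntegral_mode_ibp`. [cite: ColomboDelellisDerosa2018, §9 (proof of Thm. 1.1)] -/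
theorem IsFracGalerkinScheme.galerkin_weak_identity (hS : IsFracGalerkinScheme α u₀ N U)
    (hα : 0 ≤ α) (hu₀ : MemLp u₀ 2 volume) (n : ℕ) {T : ℝ} (hT : 0 < T)
    {ψ : ℝ → UnitAddTorus d → EuclideanSpace ℝ d} (hψ : FunctionSpaces.Torus.IsSpaceTimeTest T ψ)
    (hdiv : FunctionSpaces.Torus.IsDivFreeTest ψ) :
    (∫ t in (0 : ℝ)..T, ∫ x,
        (⟪U n t x, FunctionSpaces.Torus.fourierTruncate (N n) (FunctionSpaces.Torus.timeDeriv ψ t) x⟫ +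
          ⟪U n t x, FunctionSpaces.Torus.convect (U n t) (fun y => FunctionSpaces.Torus.fourierTruncate (N n) (ψ t) y) x⟫ -
          1 * ⟪U n t x, Torus.fracLaplacian α (fun y => FunctionSpaces.Torus.fourierTruncate (N n) (ψ t) y) x⟫)) +
      ∫ x, ⟪u₀ x, FunctionSpaces.Torus.fourierTruncate (N n) (ψ 0) x⟫ = 0 := by
  classical
  choose v hvT hv using fun k : d → ℤ => Torus.exists_transversal_frame (d := d) k
  choose C hC using fun l : d × Bool => Torus.exists_coordCLM (d := d) l
  set I : Finset ((d → ℤ) × (d × Bool)) := FunctionSpaces.Torus.freqBall (N n) ×ˢ Finset.univ with hI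
  set a : (d → ℤ) × (d × Bool) → UnitAddTorus d → EuclideanSpace ℝ d :=
    fun i => FunctionSpaces.Torus.realTrigPoly {i.1} (fun _ => v i.1 i.2) with ha
  have ha_mode : ∀ i ∈ I, IsGalerkinMode (N n) (a i) := by
    intro i hi
    exact isGalerkinMode_realTrigPoly_singleton (Finset.mem_product.1 hi).1 (hvT i.1 i.2)
  have ha_smooth : ∀ i, FunctionSpaces.Torus.IsSmooth (a i) := fun i => FunctionSpaces.Torus.isSmooth_realTrigPoly _ _
  set lam : ℝ → (d → ℤ) × (d × Bool) → ℝ :=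
    fun t i => C i.2 (mFourierCoeff (FunctionSpaces.EuclideanSpace.complexify ∘ ψ t) i.1) with hlam
  set lam' : ℝ → (d → ℤ) × (d × Bool) → ℝ :=
    fun t i => C i.2 (mFourierCoeff (FunctionSpaces.EuclideanSpace.complexify ∘ FunctionSpaces.Torus.timeDeriv ψ t) i.1) with hlam'
  have hderiv : ∀ i t, HasDerivAt (fun s => lam s i) (lam' t i) t := fun i t =>
    (C i.2).hasFDerivAt.comp_hasDerivAt t
      (FunctionSpaces.Torus.hasDerivAt_mFourierCoeff_slice (hψ.isSmoothSpaceTimeOn Set.univ) i.1 t)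
  have hcont' : ∀ i, Continuous fun t => lam' t i := fun i =>
    (C i.2).continuous.comp (hψ.timeDeriv.continuous_mFourierCoeff i.1)
  have hlamT : ∀ i, lam T i = 0 := by
    intro i
    simp only [hlam, hψ.eq_zero_of_le le_rfl]
    have : mFourierCoeff (FunctionSpaces.EuclideanSpace.complexify ∘ (0 : UnitAddTorus d → EuclideanSpace ℝ d)) i.1 = 0 := by
      simp [mFourierCoeff]
    rw [this, map_zero]
  have hR : ∀ t x, FunctionSpaces.Torus.fourierTruncate (N n) (ψ t) x = ∑ i ∈ I, lam t i • a i x := by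
    intro t x
    rw [Torus.fourierTruncate_eq_sum_frame hv (fun k =>
      FunctionSpaces.Torus.IsDivFree.sum_mul_mFourierCoeff_eq_zero (hψ.isSmooth_slice t) (hdiv t) k)]
    refine Finset.sum_congr rfl fun i _ => ?_
    simp only [hlam, ha, hC]
  have hR' : ∀ t x, FunctionSpaces.Torus.fourierTruncate (N n) (FunctionSpaces.Torus.timeDeriv ψ t) x = ∑ i ∈ I, lam' t i • a i x := by
    intro t x
    rw [Torus.fourierTruncate_eq_sum_frame hv (fun k =>
      hψ.sum_mul_mFourierCoeff_timeDeriv_eq_zero hdiv k t)]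
    refine Finset.sum_congr rfl fun i _ => ?_
    simp only [hlam', ha, hC]
  have hRfun : ∀ t, (fun y => FunctionSpaces.Torus.fourierTruncate (N n) (ψ t) y) = fun x => ∑ i ∈ I, lam t i • a i x :=
    fun t => funext (hR t)
  -- the one-mode identities, summed
  have hsum := Finset.sum_congr rfl fun i (hi : i ∈ I) =>
    hS.intervalIntegral_mode_ibp hα n (ha_mode i hi) (hderiv i) (hcont' i) hT (hlamT i)
  have hcst : ∀ i, ContinuousOn (FunctionSpaces.Torus.stLift fun (_ : ℝ) x => a i x) (Set.Ici 0 ×ˢ Set.univ) := fun i =>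
    ((ha_smooth i).continuous.comp (FunctionSpaces.Torus.continuous_proj.comp continuous_snd)).continuousOn
  have hG : ∀ i, ContinuousOn (fun t => ∫ x, ⟪U n t x, a i x⟫) (Set.Icc 0 T) := fun i =>
    (FunctionSpaces.Torus.continuousOn_integral_inner_of_continuousOn_stLift (hS.continuousOn n) (hcst i)).mono
      Set.Icc_subset_Ici_self
  have hh : ∀ i, ContinuousOn (fun t => ∫ x, (⟪U n t x, FunctionSpaces.Torus.convect (U n t) (a i) x⟫ -
      ⟪U n t x, Torus.fracLaplacian α (a i) x⟫)) (Set.Icc 0 T) := fun i =>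
    (hS.continuousOn_galerkin_rhs hα n (ha_smooth i)).mono Set.Icc_subset_Ici_self
  have hlamc : ∀ i, Continuous fun t => lam t i := fun i =>
    continuous_iff_continuousAt.2 fun t => (hderiv i t).continuousAt
  have hint : ∀ i ∈ I, IntervalIntegrable (fun t => lam' t i * (∫ x, ⟪U n t x, a i x⟫) +
      lam t i * ∫ x, (⟪U n t x, FunctionSpaces.Torus.convect (U n t) (a i) x⟫ -
        ⟪U n t x, Torus.fracLaplacian α (a i) x⟫)) volume 0 T := fun i _ =>
    (((hcont' i).continuousOn.mul (hG i)).add ((hlamc i).continuousOn.mul (hh i))).intervalIntegrable_of_Icc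
      hT.le
  rw [← intervalIntegral.integral_finsetSum hint] at hsum
  -- identify the right-hand side
  have hrhs : ∑ i ∈ I, -(lam 0 i * ∫ x, ⟪u₀ x, a i x⟫) =
      -∫ x, ⟪u₀ x, FunctionSpaces.Torus.fourierTruncate (N n) (ψ 0) x⟫ := by
    rw [Finset.sum_neg_distrib, neg_inj]
    simp_rw [hR 0, inner_sum, inner_smul_right]
    rw [integral_finsetSum I fun i _ =>
      (FunctionSpaces.Torus.integrable_inner_of_continuous (hu₀.integrable one_le_two) (ha_smooth i).continuous).const_mul _]
    exact Finset.sum_congr rfl fun i _ => (integral_const_mul _ _).symm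
  -- identify the left-hand side, slice by slice
  have hlhs : ∀ t ∈ Set.Icc 0 T, ∑ i ∈ I, (lam' t i * (∫ x, ⟪U n t x, a i x⟫) +
      lam t i * ∫ x, (⟪U n t x, FunctionSpaces.Torus.convect (U n t) (a i) x⟫ -
        ⟪U n t x, Torus.fracLaplacian α (a i) x⟫)) =
      ∫ x, (⟪U n t x, FunctionSpaces.Torus.fourierTruncate (N n) (FunctionSpaces.Torus.timeDeriv ψ t) x⟫ +
        ⟪U n t x, FunctionSpaces.Torus.convect (U n t) (fun y => FunctionSpaces.Torus.fourierTruncate (N n) (ψ t) y) x⟫ -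
        1 * ⟪U n t x, Torus.fracLaplacian α (fun y => FunctionSpaces.Torus.fourierTruncate (N n) (ψ t) y) x⟫) := by
    intro t ht
    have ht0 : 0 ≤ t := ht.1
    have hcU : Continuous (U n t) := hS.continuous_slice n ht0
    have hconv_cont : ∀ i, Continuous fun x => FunctionSpaces.Torus.convect (U n t) (a i) x := by
      intro i
      have h : (fun x => FunctionSpaces.Torus.convect (U n t) (a i) x) =
          fun x => ∑ j, (U n t x) j • FunctionSpaces.Torus.partialDeriv j (a i) x := by
        funext x; exact FunctionSpaces.Torus.fderiv_apply_eq_sum_partialDeriv ((ha_smooth i).isContDiff (by simp)) _ _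
      rw [h]
      exact continuous_finsetSum _ fun j _ =>
        (((EuclideanSpace.proj (𝕜 := ℝ) j).continuous.comp hcU).smul ((ha_smooth i).partialDeriv j).continuous)
    have iA : ∀ i, Integrable (fun x => ⟪U n t x, a i x⟫) volume := fun i =>
      (hcU.inner (ha_smooth i).continuous).integrable_unitAddTorus
    have iB : ∀ i, Integrable (fun x => ⟪U n t x, FunctionSpaces.Torus.convect (U n t) (a i) x⟫ -
        ⟪U n t x, Torus.fracLaplacian α (a i) x⟫) volume := fun i =>
      ((hcU.inner (hconv_cont i)).sub (hcU.inner (Torus.continuous_fracLaplacian hα (ha_smooth i)))).integrable_unitAddTorus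
    have hstep : ∀ i ∈ I, lam' t i * (∫ x, ⟪U n t x, a i x⟫) +
        lam t i * ∫ x, (⟪U n t x, FunctionSpaces.Torus.convect (U n t) (a i) x⟫ -
          ⟪U n t x, Torus.fracLaplacian α (a i) x⟫) =
        ∫ x, (lam' t i * ⟪U n t x, a i x⟫ + lam t i * (⟪U n t x, FunctionSpaces.Torus.convect (U n t) (a i) x⟫ -
          ⟪U n t x, Torus.fracLaplacian α (a i) x⟫)) := by
      intro i _
      rw [integral_add ((iA i).const_mul _) ((iB i).const_mul _), integral_const_mul, integral_const_mul]
    have iAB : ∀ i ∈ I, Integrable (fun x => lam' t i * ⟪U n t x, a i x⟫ +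
        lam t i * (⟪U n t x, FunctionSpaces.Torus.convect (U n t) (a i) x⟫ -
          ⟪U n t x, Torus.fracLaplacian α (a i) x⟫)) volume := fun i _ =>
      ((iA i).const_mul _).add ((iB i).const_mul _)
    rw [Finset.sum_congr rfl hstep, ← integral_finsetSum I iAB]
    refine integral_congr_ae (ae_of_all _ fun x => ?_)
    dsimp only
    rw [hR' t x, hRfun t, Torus.convect_finset_sum_smul I (lam t) ha_smooth,
      Torus.fracLaplacian_finset_sum_smul hα I (lam t) ha_smooth]
    simp only [inner_sum, inner_smul_right, Finset.mul_sum, ← Finset.sum_add_distrib, one_mul,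
      ← Finset.sum_sub_distrib]
    refine Finset.sum_congr rfl fun i _ => ?_
    ring
  rw [intervalIntegral.integral_congr (fun t ht => hlhs t (by rwa [Set.uIcc_of_le hT.le] at ht))] at hsum
  rw [hrhs] at hsum
  linarith

end GalerkinWeak

/-! ## Passage to the limit `n → ∞` in the weak-form functional -/

section Limit

variable {T : ℝ} {ψ : ℝ → UnitAddTorus d → EuclideanSpace ℝ d}

/-- **`L¹(0,T)` convergence of the fractional weak-form slice functionals** (CDLDR 2018, §9: the
strong `L²_loc` convergence passes to the limit in the weak formulation, the nonlinear term
included; RRS 2016, Thm. 4.4 Step 4 for `α = 1`): with `ψ` a fixed test field on `[0, T)`,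
`Φ(W)(t) = ∫ (⟪W, ∂ₜψ⟫ + ⟪W, (W·∇)ψ⟫ - ⟪W, (-Δ)^α ψ⟫)(t)`, `∫₀ᵀ |Φ(U n)(t) - Φ(u)(t)| dt → 0`
(the generic slice estimate `Torus.enorm_sliceFunctional_sub_le` with vanishing forces, integrated
in time; `U n → u` in `L²ₜₓ`, `U n`, `u` bounded in `L²ₜₓ`; choose `λ` small, then `n` large).
[cite: ColomboDelellisDerosa2018, §9 (proof of Thm. 1.1)] -/
theorem IsFracGalerkinScheme.tendsto_lintegral_sliceFunctional_sub (hS : IsFracGalerkinScheme α u₀ N U)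
    (hα : 0 < α) (hu₀ : MemLp u₀ 2 volume)
    (hum : AEStronglyMeasurable (FunctionSpaces.Torus.stLift u) (volume.restrict (Set.Ioi 0 ×ˢ Set.univ)))
    (hu : ∀ t, 0 ≤ t → MemLp (u t) 2 volume)
    (hc : ∀ t, 0 ≤ t → ∀ k, Tendsto (fun n => mFourierCoeff (FunctionSpaces.EuclideanSpace.complexify ∘ U n t) k)
      atTop (𝓝 (mFourierCoeff (FunctionSpaces.EuclideanSpace.complexify ∘ u t) k)))
    (hψ : FunctionSpaces.Torus.IsSpaceTimeTest T ψ) :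
    Tendsto (fun n => ∫⁻ t in Set.Ioo 0 T, ‖(∫ x, (⟪U n t x, FunctionSpaces.Torus.timeDeriv ψ t x⟫ +
        ⟪U n t x, FunctionSpaces.Torus.convect (U n t) (ψ t) x⟫ - 1 * ⟪U n t x, Torus.fracLaplacian α (ψ t) x⟫)) -
      ∫ x, (⟪u t x, FunctionSpaces.Torus.timeDeriv ψ t x⟫ + ⟪u t x, FunctionSpaces.Torus.convect (u t) (ψ t) x⟫ -
        1 * ⟪u t x, Torus.fracLaplacian α (ψ t) x⟫)‖ₑ) atTop (𝓝 0) := by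
  obtain ⟨Y, hYdef⟩ : ∃ Y : ℝ, Y = ∫ x, ‖u₀ x‖ ^ 2 := ⟨_, rfl⟩
  have hYn : ∀ n t, 0 ≤ t → ∫ x, ‖U n t x‖ ^ 2 ≤ Y := fun n t ht => by
    rw [hYdef]; exact hS.integral_norm_sq_le hu₀ n ht
  have hYu : ∀ t, 0 ≤ t → ∫ x, ‖u t x‖ ^ 2 ≤ Y := fun t ht => by
    rw [hYdef]; exact hS.integral_norm_sq_limit_le hu₀ hu hc ht
  have hY0 : 0 ≤ Y := le_trans (integral_nonneg fun x => sq_nonneg _) (hYu 0 le_rfl)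
  obtain ⟨Kp, -, -, C, -, hKp, -, -, hC⟩ := hψ.exists_bounds
  obtain ⟨KL, -, hKL⟩ := Torus.exists_norm_fracLaplacian_le hα.le (hψ.isSmoothSpaceTimeOn Set.univ)
    (isCompact_Icc (a := (0 : ℝ)) (b := T))
  have hZ : Tendsto (fun n => ∫⁻ τ in Set.Ioo 0 T, ∫⁻ x, ‖U n τ x - u τ x‖ₑ ^ 2) atTop (𝓝 0) :=
    hS.tendsto_lintegral_enorm_sub_sq hα hu₀ hum hu hc T
  have hBU : ∀ n, ∫⁻ τ in Set.Ioo 0 T, ∫⁻ x, ‖U n τ x‖ₑ ^ 2 ≤ ENNReal.ofReal (T * Y) := by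
    intro n
    calc ∫⁻ τ in Set.Ioo 0 T, ∫⁻ x, ‖U n τ x‖ₑ ^ 2 ≤ ∫⁻ _ in Set.Ioo 0 T, ENNReal.ofReal Y := by
          refine setLIntegral_mono' measurableSet_Ioo fun τ hτ => ?_
          rw [← ofReal_integral_norm_sq_slice (hS.continuousOn n) hτ.1.le]
          exact ENNReal.ofReal_le_ofReal (hYn n τ hτ.1.le)
      _ = ENNReal.ofReal (T * Y) := by
          rw [setLIntegral_const, Real.volume_Ioo, sub_zero, ← ENNReal.ofReal_mul hY0, mul_comm]
  have hBu : ∫⁻ τ in Set.Ioo 0 T, ∫⁻ x, ‖u τ x‖ₑ ^ 2 ≤ ENNReal.ofReal (T * Y) := by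
    calc ∫⁻ τ in Set.Ioo 0 T, ∫⁻ x, ‖u τ x‖ₑ ^ 2 ≤ ∫⁻ _ in Set.Ioo 0 T, ENNReal.ofReal Y := by
          refine setLIntegral_mono' measurableSet_Ioo fun τ hτ => ?_
          rw [Torus.lintegral_enorm_sq_eq_ofReal (hu τ hτ.1.le)]
          exact ENNReal.ofReal_le_ofReal (hYu τ hτ.1.le)
      _ = ENNReal.ofReal (T * Y) := by
          rw [setLIntegral_const, Real.volume_Ioo, sub_zero, ← ENNReal.ofReal_mul hY0, mul_comm]
  have hm2 : ∀ n, AEMeasurable (fun τ => ∫⁻ x, ‖U n τ x‖ₑ ^ 2) (volume.restrict (Set.Ioo 0 T)) :=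
    fun n => Torus.aemeasurable_lintegral_enorm_sq (hS.aestronglyMeasurable_stLift n) T
  have hm3 : ∀ n, AEMeasurable (fun τ => ∫⁻ x, ‖U n τ x - u τ x‖ₑ ^ 2) (volume.restrict (Set.Ioo 0 T)) :=
    fun n => Torus.aemeasurable_lintegral_enorm_sub_sq (hS.aestronglyMeasurable_stLift n) hum T
  have hm4 : AEMeasurable (fun τ => ∫⁻ x, ‖u τ x‖ₑ ^ 2) (volume.restrict (Set.Ioo 0 T)) :=
    Torus.aemeasurable_lintegral_enorm_sq hum T
  set Kc : ℝ≥0∞ := ENNReal.ofReal (Kp ^ 2 + KL ^ 2) with hKc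
  have hint : ∀ {lam : ℝ}, 0 < lam → ∀ n,
      ∫⁻ t in Set.Ioo 0 T, ‖(∫ x, (⟪U n t x, FunctionSpaces.Torus.timeDeriv ψ t x⟫ +
          ⟪U n t x, FunctionSpaces.Torus.convect (U n t) (ψ t) x⟫ - 1 * ⟪U n t x, Torus.fracLaplacian α (ψ t) x⟫)) -
        ∫ x, (⟪u t x, FunctionSpaces.Torus.timeDeriv ψ t x⟫ + ⟪u t x, FunctionSpaces.Torus.convect (u t) (ψ t) x⟫ -
          1 * ⟪u t x, Torus.fracLaplacian α (ψ t) x⟫)‖ₑ ≤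
        ENNReal.ofReal (lam / 2) * (Kc * ENNReal.ofReal T + ENNReal.ofReal (C ^ 2) *
          (ENNReal.ofReal (T * Y) + ENNReal.ofReal (T * Y))) +
          ENNReal.ofReal (2 * lam)⁻¹ * (4 * ∫⁻ τ in Set.Ioo 0 T, ∫⁻ x, ‖U n τ x - u τ x‖ₑ ^ 2) := by
    intro lam hlam n
    have hpt : ∀ᵐ t ∂(volume.restrict (Set.Ioo 0 T)),
        ‖(∫ x, (⟪U n t x, FunctionSpaces.Torus.timeDeriv ψ t x⟫ +
            ⟪U n t x, FunctionSpaces.Torus.convect (U n t) (ψ t) x⟫ - 1 * ⟪U n t x, Torus.fracLaplacian α (ψ t) x⟫)) -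
          ∫ x, (⟪u t x, FunctionSpaces.Torus.timeDeriv ψ t x⟫ + ⟪u t x, FunctionSpaces.Torus.convect (u t) (ψ t) x⟫ -
            1 * ⟪u t x, Torus.fracLaplacian α (ψ t) x⟫)‖ₑ ≤
          ENNReal.ofReal (2 * lam)⁻¹ * (4 * (∫⁻ x, ‖U n t x - u t x‖ₑ ^ 2)) +
            ENNReal.ofReal (lam / 2) * (Kc + ENNReal.ofReal (C ^ 2) *
              ((∫⁻ x, ‖U n t x‖ₑ ^ 2) + ∫⁻ x, ‖u t x‖ₑ ^ 2)) := by
      filter_upwards [ae_restrict_mem measurableSet_Ioo] with t ht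
      have ht' : t ∈ Set.Icc 0 T := ⟨ht.1.le, ht.2.le⟩
      exact Torus.enorm_fracSliceFunctional_sub_le (hS.memLp_slice n ht.1.le) (hu t ht.1.le)
        (hψ.isSmooth_slice t) (hψ.timeDeriv.isSmooth_slice t).continuous
        (Torus.continuous_fracLaplacian hα.le (hψ.isSmooth_slice t)) (hC t ht') (hKp t ht') (hKL t ht') hlam
    refine (lintegral_mono_ae hpt).trans ?_
    have mA : AEMeasurable (fun t => 4 * (∫⁻ x, ‖U n t x - u t x‖ₑ ^ 2)) (volume.restrict (Set.Ioo 0 T)) :=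
      (hm3 n).const_mul _
    have m24 : AEMeasurable (fun t => (∫⁻ x, ‖U n t x‖ₑ ^ 2) + ∫⁻ x, ‖u t x‖ₑ ^ 2)
        (volume.restrict (Set.Ioo 0 T)) := (hm2 n).add hm4
    have mB : AEMeasurable (fun t => Kc + ENNReal.ofReal (C ^ 2) *
        ((∫⁻ x, ‖U n t x‖ₑ ^ 2) + ∫⁻ x, ‖u t x‖ₑ ^ 2)) (volume.restrict (Set.Ioo 0 T)) :=
      (m24.const_mul _).const_add _
    rw [lintegral_add_left' (mA.const_mul _), lintegral_const_mul'' _ mA, lintegral_const_mul'' _ mB,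
      lintegral_const_mul'' _ (hm3 n),
      lintegral_add_left' aemeasurable_const, lintegral_const_mul'' _ m24,
      lintegral_add_left' (hm2 n), setLIntegral_const, Real.volume_Ioo, sub_zero]
    rw [add_comm]
    have h1 := hBU n
    gcongr
  refine ENNReal.tendsto_zero_of_forall_le_ofReal_mul_add
    (C := Kc * ENNReal.ofReal T + ENNReal.ofReal (C ^ 2) * (ENNReal.ofReal (T * Y) + ENNReal.ofReal (T * Y)))
    ?_ (X := fun lam n => ENNReal.ofReal (2 * (2 * lam))⁻¹ *
      (4 * ∫⁻ τ in Set.Ioo 0 T, ∫⁻ x, ‖U n τ x - u τ x‖ₑ ^ 2)) (fun lam hlam => ?_) (fun lam hlam => ?_)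
  · exact ENNReal.add_ne_top.2 ⟨ENNReal.mul_ne_top ENNReal.ofReal_ne_top ENNReal.ofReal_ne_top,
      ENNReal.mul_ne_top ENNReal.ofReal_ne_top (ENNReal.add_ne_top.2
        ⟨ENNReal.ofReal_ne_top, ENNReal.ofReal_ne_top⟩)⟩
  · have h4 : Tendsto (fun n => (4 : ℝ≥0∞) * ∫⁻ τ in Set.Ioo 0 T, ∫⁻ x, ‖U n τ x - u τ x‖ₑ ^ 2) atTop
        (𝓝 ((4 : ℝ≥0∞) * 0)) :=
      ENNReal.Tendsto.const_mul hZ (Or.inr (by norm_num))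
    have h := ENNReal.Tendsto.const_mul h4 (a := ENNReal.ofReal (2 * (2 * lam))⁻¹)
      (Or.inr ENNReal.ofReal_ne_top)
    simpa using h
  · refine Eventually.of_forall fun n => ?_
    have h := hint (lam := 2 * lam) (by positivity) n
    rwa [show 2 * lam / 2 = lam by ring] at h

/-- **The fractional weak-form functionals converge**: `∫₀ᵀ Φ(U n) → ∫₀ᵀ Φ(u)` for every test
field (`tendsto_integral_of_L1` on `(0, T)`). [cite: ColomboDelellisDerosa2018, §9 (proof of Thm. 1.1)] -/
theorem IsFracGalerkinScheme.tendsto_integral_sliceFunctional (hS : IsFracGalerkinScheme α u₀ N U)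
    (hα : 0 < α) (hu₀ : MemLp u₀ 2 volume)
    (hum : AEStronglyMeasurable (FunctionSpaces.Torus.stLift u) (volume.restrict (Set.Ioi 0 ×ˢ Set.univ)))
    (hu : ∀ t, 0 ≤ t → MemLp (u t) 2 volume)
    (hc : ∀ t, 0 ≤ t → ∀ k, Tendsto (fun n => mFourierCoeff (FunctionSpaces.EuclideanSpace.complexify ∘ U n t) k)
      atTop (𝓝 (mFourierCoeff (FunctionSpaces.EuclideanSpace.complexify ∘ u t) k)))
    (hψ : FunctionSpaces.Torus.IsSpaceTimeTest T ψ) :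
    Tendsto (fun n => ∫ t in Set.Ioo 0 T, ∫ x, (⟪U n t x, FunctionSpaces.Torus.timeDeriv ψ t x⟫ +
        ⟪U n t x, FunctionSpaces.Torus.convect (U n t) (ψ t) x⟫ - 1 * ⟪U n t x, Torus.fracLaplacian α (ψ t) x⟫)) atTop
      (𝓝 (∫ t in Set.Ioo 0 T, ∫ x, (⟪u t x, FunctionSpaces.Torus.timeDeriv ψ t x⟫ +
        ⟪u t x, FunctionSpaces.Torus.convect (u t) (ψ t) x⟫ - 1 * ⟪u t x, Torus.fracLaplacian α (ψ t) x⟫))) := by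
  refine tendsto_integral_of_L1 (μ := volume.restrict (Set.Ioo 0 T)) _
    ((Torus.aestronglyMeasurable_fracWeakFunctional hα.le hum hψ (ν := 1)).mono_measure
      (Measure.restrict_mono Set.Ioo_subset_Ioi_self le_rfl)) (Eventually.of_forall fun n => ?_)
    (hS.tendsto_lintegral_sliceFunctional_sub hα hu₀ hum hu hc hψ)
  exact ((Torus.continuousOn_fracWeakFunctional hα.le (hS.continuousOn n) hψ (ν := 1)).mono
    Set.Icc_subset_Ici_self).integrableOn_Icc.mono_set Set.Ioo_subset_Icc_self

end Limit

/-! ## The truncation error and the weak form of the limit -/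

section WeakForm

variable {T : ℝ} {ψ : ℝ → UnitAddTorus d → EuclideanSpace ℝ d}

/-- **Slice bound for the truncation error of the fractional weak-form functional**: for
`t ≥ 0`, given the uniform truncation errors `e₁, e₂` of `∂ₜψ, (-Δ)^α ψ` and `e₃` of
`∑ᵢ ‖∂ᵢψ - P_M ∂ᵢψ‖` at time `t`,
`|Φₙ(ψ)(t) - Φₙ(P_M ψ)(t)| ≤ (e₁/2 + e₂/2 + e₃) ∫‖U n t‖² + (e₁/2 + e₂/2)`. [folklore] -/
theorem IsFracGalerkinScheme.norm_sliceFunctional_trunc_sub_le (hS : IsFracGalerkinScheme α u₀ N U)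
    (hα : 0 ≤ α) (hψ : FunctionSpaces.Torus.IsSpaceTimeTest T ψ) (n M : ℕ) {t : ℝ} (ht0 : 0 ≤ t) {e₁ e₂ e₃ : ℝ}
    (he₁ : 0 ≤ e₁) (he₂ : 0 ≤ e₂)
    (h₁ : ∀ x, ‖FunctionSpaces.Torus.timeDeriv ψ t x - FunctionSpaces.Torus.fourierTruncate M (FunctionSpaces.Torus.timeDeriv ψ t) x‖ ≤ e₁)
    (h₂ : ∀ x, ‖Torus.fracLaplacian α (ψ t) x - Torus.fracLaplacian α (fun y => FunctionSpaces.Torus.fourierTruncate M (ψ t) y) x‖ ≤ e₂)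
    (h₃ : ∀ x, ∑ i, ‖FunctionSpaces.Torus.partialDeriv i (ψ t) x -
      FunctionSpaces.Torus.fourierTruncate M (FunctionSpaces.Torus.partialDeriv i (ψ t)) x‖ ≤ e₃) :
    ‖(∫ x, (⟪U n t x, FunctionSpaces.Torus.timeDeriv ψ t x⟫ +
        ⟪U n t x, FunctionSpaces.Torus.convect (U n t) (ψ t) x⟫ - 1 * ⟪U n t x, Torus.fracLaplacian α (ψ t) x⟫)) -
      ∫ x, (⟪U n t x, FunctionSpaces.Torus.fourierTruncate M (FunctionSpaces.Torus.timeDeriv ψ t) x⟫ +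
        ⟪U n t x, FunctionSpaces.Torus.convect (U n t) (fun y => FunctionSpaces.Torus.fourierTruncate M (ψ t) y) x⟫ -
        1 * ⟪U n t x, Torus.fracLaplacian α (fun y => FunctionSpaces.Torus.fourierTruncate M (ψ t) y) x⟫)‖ ≤
      (e₁ / 2 + e₂ / 2 + e₃) * (∫ x, ‖U n t x‖ ^ 2) + (e₁ / 2 + e₂ / 2) := by
  have hcU : Continuous (U n t) := hS.continuous_slice n ht0
  have hmU : MemLp (U n t) 2 volume := hS.memLp_slice n ht0
  have hPs := Torus.isSmooth_fourierTruncate_slice ψ M t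
  have hsl := hψ.isSmooth_slice t
  have i1 := Torus.integrable_fracWeakIntegrand hmU hsl (hψ.timeDeriv.isSmooth_slice t).continuous
    (Torus.continuous_fracLaplacian hα hsl)
  have hPp : Continuous (fun x => FunctionSpaces.Torus.fourierTruncate M (FunctionSpaces.Torus.timeDeriv ψ t) x) := by
    rw [show (fun x => FunctionSpaces.Torus.fourierTruncate M (FunctionSpaces.Torus.timeDeriv ψ t) x) =
      FunctionSpaces.Torus.fourierTruncate M (FunctionSpaces.Torus.timeDeriv ψ t) from rfl, FunctionSpaces.Torus.fourierTruncate_eq]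
    exact (FunctionSpaces.Torus.isSmooth_realTrigPoly _ _).continuous
  have i2 := Torus.integrable_fracWeakIntegrand hmU hPs hPp (Torus.continuous_fracLaplacian hα hPs)
  rw [← integral_sub i1 i2]
  have hpt : ∀ x, ‖(⟪U n t x, FunctionSpaces.Torus.timeDeriv ψ t x⟫ +
      ⟪U n t x, FunctionSpaces.Torus.convect (U n t) (ψ t) x⟫ - 1 * ⟪U n t x, Torus.fracLaplacian α (ψ t) x⟫) -
      (⟪U n t x, FunctionSpaces.Torus.fourierTruncate M (FunctionSpaces.Torus.timeDeriv ψ t) x⟫ +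
      ⟪U n t x, FunctionSpaces.Torus.convect (U n t) (fun y => FunctionSpaces.Torus.fourierTruncate M (ψ t) y) x⟫ -
      1 * ⟪U n t x, Torus.fracLaplacian α (fun y => FunctionSpaces.Torus.fourierTruncate M (ψ t) y) x⟫)‖ ≤
      (e₁ / 2 + e₂ / 2 + e₃) * ‖U n t x‖ ^ 2 + (e₁ / 2 + e₂ / 2) := by
    intro x
    have hd : (⟪U n t x, FunctionSpaces.Torus.timeDeriv ψ t x⟫ +
        ⟪U n t x, FunctionSpaces.Torus.convect (U n t) (ψ t) x⟫ - 1 * ⟪U n t x, Torus.fracLaplacian α (ψ t) x⟫) -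
        (⟪U n t x, FunctionSpaces.Torus.fourierTruncate M (FunctionSpaces.Torus.timeDeriv ψ t) x⟫ +
        ⟪U n t x, FunctionSpaces.Torus.convect (U n t) (fun y => FunctionSpaces.Torus.fourierTruncate M (ψ t) y) x⟫ -
        1 * ⟪U n t x, Torus.fracLaplacian α (fun y => FunctionSpaces.Torus.fourierTruncate M (ψ t) y) x⟫) =
        ⟪U n t x, FunctionSpaces.Torus.timeDeriv ψ t x - FunctionSpaces.Torus.fourierTruncate M (FunctionSpaces.Torus.timeDeriv ψ t) x⟫ +
        ⟪U n t x, FunctionSpaces.Torus.convect (U n t) (fun y => ψ t y - FunctionSpaces.Torus.fourierTruncate M (ψ t) y) x⟫ -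
        1 * ⟪U n t x, Torus.fracLaplacian α (ψ t) x - Torus.fracLaplacian α (fun y => FunctionSpaces.Torus.fourierTruncate M (ψ t) y) x⟫ := by
      rw [Torus.convect_sub_apply hsl hPs]
      simp only [inner_sub_right]
      ring
    rw [hd, Real.norm_eq_abs]
    refine Torus.abs_fracWeakIntegrand_trunc_le _ _ _ _ he₁ he₂ (h₁ x) (h₂ x) ?_
    have e3 : ∑ i, ‖FunctionSpaces.Torus.partialDeriv i (fun y => ψ t y - FunctionSpaces.Torus.fourierTruncate M (ψ t) y) x‖ ≤ e₃ := by
      refine le_trans (le_of_eq (Finset.sum_congr rfl fun i _ => ?_)) (h₃ x)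
      rw [Torus.partialDeriv_sub_apply hsl hPs, FunctionSpaces.Torus.partialDeriv_fourierTruncate hsl]
    exact (FunctionSpaces.Torus.norm_convect_le (U n t) ((hsl.sub hPs).isContDiff (by simp)) x).trans
      (mul_le_mul_of_nonneg_left e3 (norm_nonneg _))
  have iU : Integrable (fun x => ‖U n t x‖ ^ 2) volume := (hcU.norm.pow 2).integrable_unitAddTorus
  have i12 : Integrable (fun x => (e₁ / 2 + e₂ / 2 + e₃) * ‖U n t x‖ ^ 2 + (e₁ / 2 + e₂ / 2)) volume :=
    (iU.const_mul _).add (integrable_const _)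
  refine (norm_integral_le_of_norm_le i12 (ae_of_all _ hpt)).trans (le_of_eq ?_)
  rw [integral_add (iU.const_mul _) (integrable_const _), integral_const_mul, integral_const]
  simp [Measure.real]

/-- **The fractional weak-form functional of the approximations tends to zero**
(CDLDR 2018, §9 via the `α = 1` template RRS 2016, Thm. 4.4 Step 4: `P_M ψ → ψ` with derivatives,
so the Galerkin identity tested against `P_{N n} ψ` differs from the one tested against `ψ` by
`o(1)` times the uniform bounds): with `E_n(ψ) = ∫₀ᵀ Φ(U n) + ∫⟪u₀, ψ(0)⟫`, `E_n(ψ) → 0`, because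
`E_n(P_{N n} ψ) = 0` (`galerkin_weak_identity`) and `|E_n(ψ) - E_n(P_{N n}ψ)| ≤ τ_{N n} · const`
with the lattice tail `τ_M → 0`. [cite: ColomboDelellisDerosa2018, §9 (proof of Thm. 1.1)] -/
theorem IsFracGalerkinScheme.tendsto_weakFunctional (hS : IsFracGalerkinScheme α u₀ N U)
    (hα : 0 ≤ α) (hu₀ : MemLp u₀ 2 volume) (hT : 0 < T)
    (hψ : FunctionSpaces.Torus.IsSpaceTimeTest T ψ) (hdiv : FunctionSpaces.Torus.IsDivFreeTest ψ) :
    Tendsto (fun n => (∫ t in Set.Ioo 0 T, ∫ x, (⟪U n t x, FunctionSpaces.Torus.timeDeriv ψ t x⟫ +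
        ⟪U n t x, FunctionSpaces.Torus.convect (U n t) (ψ t) x⟫ - 1 * ⟪U n t x, Torus.fracLaplacian α (ψ t) x⟫)) +
        ∫ x, ⟪u₀ x, ψ 0 x⟫) atTop (𝓝 0) := by
  obtain ⟨Y, hYdef⟩ : ∃ Y : ℝ, Y = ∫ x, ‖u₀ x‖ ^ 2 := ⟨_, rfl⟩
  have hYn : ∀ n t, 0 ≤ t → ∫ x, ‖U n t x‖ ^ 2 ≤ Y := fun n t ht => by
    rw [hYdef]; exact hS.integral_norm_sq_le hu₀ n ht
  have hY0 : 0 ≤ Y := le_trans (integral_nonneg fun x => sq_nonneg _) (hYn 0 0 le_rfl)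
  -- uniform truncation errors of the test data
  obtain ⟨K₀, hK₀0, hK₀⟩ := FunctionSpaces.Torus.exists_norm_sub_fourierTruncate_le_spaceTime (hψ.isSmoothSpaceTimeOn Set.univ) T
  obtain ⟨K₁, hK₁0, hK₁⟩ := FunctionSpaces.Torus.exists_norm_sub_fourierTruncate_le_spaceTime
    (hψ.timeDeriv.isSmoothSpaceTimeOn Set.univ) T
  obtain ⟨K₂, hK₂0, hK₂⟩ := Torus.exists_norm_fracLaplacian_sub_fourierTruncate_le_spaceTime hα
    (hψ.isSmoothSpaceTimeOn Set.univ) T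
  choose K₃ hK₃0 hK₃ using fun i => FunctionSpaces.Torus.exists_norm_sub_fourierTruncate_le_spaceTime
    (hψ.isSmoothSpaceTimeOn_partialDeriv i) T
  obtain ⟨τ, hτdef⟩ : ∃ τ : ℕ → ℝ, τ = fun M => ∑' k : {k // k ∉ FunctionSpaces.Torus.freqBall (d := d) M},
    ((1 + FunctionSpaces.Torus.freqNormSq (k : d → ℤ)) ^ Fintype.card d)⁻¹ := ⟨_, rfl⟩
  have hτ0 : ∀ M, 0 ≤ τ M := fun M => by
    rw [hτdef]
    exact tsum_nonneg fun k => inv_nonneg.2 (pow_nonneg (by linarith [FunctionSpaces.Torus.freqNormSq_nonneg (k : d → ℤ)]) _)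
  have hτlim : Tendsto (fun n => τ (N n)) atTop (𝓝 0) := by
    rw [hτdef]
    exact FunctionSpaces.Torus.tendsto_tsum_compl_freqBall_inv_pow.comp hS.tendsto_order
  obtain ⟨K3, hK3def⟩ : ∃ K3 : ℝ, K3 = ∑ i, K₃ i := ⟨_, rfl⟩
  have hK30 : 0 ≤ K3 := by rw [hK3def]; exact Finset.sum_nonneg fun i _ => hK₃0 i
  obtain ⟨a, hadef⟩ : ∃ a : ℝ, a = (K₁ + K₂) / 2 + K3 := ⟨_, rfl⟩
  obtain ⟨c, hcdef⟩ : ∃ c : ℝ, c = (K₁ + K₂) / 2 := ⟨_, rfl⟩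
  have ha0 : 0 ≤ a := by rw [hadef]; positivity
  have hc0 : 0 ≤ c := by rw [hcdef]; positivity
  obtain ⟨Mc, hMcdef⟩ : ∃ Mc : ℝ, Mc = a * (T * Y) + c * T + K₀ * ∫ x, ‖u₀ x‖ := ⟨_, rfl⟩
  -- coefficient continuity for the truncated tests
  have hcoef : ∀ (b : ℝ → UnitAddTorus d → EuclideanSpace ℝ d), FunctionSpaces.Torus.IsSmoothSpaceTimeOn Set.univ b →
      ∀ k, Continuous fun t => mFourierCoeff (FunctionSpaces.EuclideanSpace.complexify ∘ b t) k := by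
    intro b hb k
    rw [← continuousOn_univ]
    exact FunctionSpaces.Torus.continuousOn_mFourierCoeff_of_continuousOn_stLift hb.continuousOn_stLift k
  have hbound : ∀ n, |(∫ t in Set.Ioo 0 T, ∫ x, (⟪U n t x, FunctionSpaces.Torus.timeDeriv ψ t x⟫ +
      ⟪U n t x, FunctionSpaces.Torus.convect (U n t) (ψ t) x⟫ - 1 * ⟪U n t x, Torus.fracLaplacian α (ψ t) x⟫)) +
      ∫ x, ⟪u₀ x, ψ 0 x⟫| ≤ τ (N n) * Mc := by
    intro n
    have hGW := hS.galerkin_weak_identity hα hu₀ n hT hψ hdiv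
    rw [intervalIntegral.integral_of_le hT.le, integral_Ioc_eq_integral_Ioo] at hGW
    -- continuity of the two slice functionals on `[0, T]`
    have hΦ : ContinuousOn _ (Set.Icc 0 T) :=
      (Torus.continuousOn_fracWeakFunctional hα (hS.continuousOn n) hψ (ν := 1)).mono Set.Icc_subset_Ici_self
    have hPcont : Continuous (FunctionSpaces.Torus.stLift fun t x => FunctionSpaces.Torus.fourierTruncate (N n) (ψ t) x) :=
      Torus.continuous_stLift_fourierTruncate (hcoef ψ (hψ.isSmoothSpaceTimeOn Set.univ)) _
    have hPp : Continuous (FunctionSpaces.Torus.stLift fun t x => FunctionSpaces.Torus.fourierTruncate (N n) (FunctionSpaces.Torus.timeDeriv ψ t) x) :=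
      Torus.continuous_stLift_fourierTruncate (hcoef _ (hψ.timeDeriv.isSmoothSpaceTimeOn Set.univ)) _
    have hPL : Continuous (FunctionSpaces.Torus.stLift fun t x =>
        Torus.fracLaplacian α (fun y => FunctionSpaces.Torus.fourierTruncate (N n) (ψ t) y) x) := by
      have h : (fun t x => Torus.fracLaplacian α (fun y => FunctionSpaces.Torus.fourierTruncate (N n) (ψ t) y) x) =
          fun t x => FunctionSpaces.Torus.realTrigPoly (FunctionSpaces.Torus.freqBall (N n))
            (fun k => ((Torus.fracSymbol α k : ℝ) : ℂ) • mFourierCoeff (FunctionSpaces.EuclideanSpace.complexify ∘ ψ t) k) x := by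
        funext t x
        exact Torus.fracLaplacian_fourierTruncate_eq_realTrigPoly α (hψ.isSmooth_slice t).continuous _ x
      rw [h]
      exact Torus.continuous_stLift_realTrigPoly
        (c := fun t k => ((Torus.fracSymbol α k : ℝ) : ℂ) • mFourierCoeff (FunctionSpaces.EuclideanSpace.complexify ∘ ψ t) k)
        (fun k => (continuous_const (y := ((Torus.fracSymbol α k : ℝ) : ℂ))).smul (hcoef ψ (hψ.isSmoothSpaceTimeOn Set.univ) k)) _
    have hPD : ∀ i, Continuous (FunctionSpaces.Torus.stLift fun t =>
        FunctionSpaces.Torus.partialDeriv i (fun y => FunctionSpaces.Torus.fourierTruncate (N n) (ψ t) y)) := by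
      intro i
      have h : (fun t => FunctionSpaces.Torus.partialDeriv i (fun y => FunctionSpaces.Torus.fourierTruncate (N n) (ψ t) y)) =
          fun t x => FunctionSpaces.Torus.fourierTruncate (N n) (FunctionSpaces.Torus.partialDeriv i (ψ t)) x := by
        funext t x; exact FunctionSpaces.Torus.partialDeriv_fourierTruncate (hψ.isSmooth_slice t) _ i x
      rw [h]
      exact Torus.continuous_stLift_fourierTruncate (hcoef _ (hψ.isSmoothSpaceTimeOn_partialDeriv i)) _
    have hΦP' := continuousOn_sliceFunctional_of (G := fun (_ : ℝ) (_ : UnitAddTorus d) => (0 : EuclideanSpace ℝ d))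
      (hS.continuousOn n) continuousOn_const hPp hPcont hPL (Torus.isSmooth_fourierTruncate_slice ψ (N n)) hPD (-1)
    have hΦP : ContinuousOn (fun t => ∫ x, (⟪U n t x, FunctionSpaces.Torus.fourierTruncate (N n) (FunctionSpaces.Torus.timeDeriv ψ t) x⟫ +
        ⟪U n t x, FunctionSpaces.Torus.convect (U n t) (fun y => FunctionSpaces.Torus.fourierTruncate (N n) (ψ t) y) x⟫ -
        1 * ⟪U n t x, Torus.fracLaplacian α (fun y => FunctionSpaces.Torus.fourierTruncate (N n) (ψ t) y) x⟫)) (Set.Icc 0 T) := by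
      refine (hΦP'.mono Set.Icc_subset_Ici_self).congr fun t _ => ?_
      refine integral_congr_ae (ae_of_all _ fun x => ?_)
      simp only [inner_zero_left, add_zero, neg_one_mul, one_mul, sub_eq_add_neg]
    have iΦ := (hΦ.integrableOn_Icc (μ := volume)).mono_set Set.Ioo_subset_Icc_self
    have iΦP := (hΦP.integrableOn_Icc (μ := volume)).mono_set Set.Ioo_subset_Icc_self
    have i0 : Integrable (fun x => ⟪u₀ x, ψ 0 x⟫) volume :=
      FunctionSpaces.Torus.integrable_inner_of_continuous (hu₀.integrable one_le_two) (hψ.isSmooth_slice 0).continuous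
    have i0P : Integrable (fun x => ⟪u₀ x, FunctionSpaces.Torus.fourierTruncate (N n) (ψ 0) x⟫) volume :=
      FunctionSpaces.Torus.integrable_inner_of_continuous (hu₀.integrable one_le_two)
        (Torus.isSmooth_fourierTruncate_slice ψ (N n) 0).continuous
    have hsplit : (∫ t in Set.Ioo 0 T, ∫ x, (⟪U n t x, FunctionSpaces.Torus.timeDeriv ψ t x⟫ +
        ⟪U n t x, FunctionSpaces.Torus.convect (U n t) (ψ t) x⟫ - 1 * ⟪U n t x, Torus.fracLaplacian α (ψ t) x⟫)) +
        ∫ x, ⟪u₀ x, ψ 0 x⟫ =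
        (∫ t in Set.Ioo 0 T, ((∫ x, (⟪U n t x, FunctionSpaces.Torus.timeDeriv ψ t x⟫ +
          ⟪U n t x, FunctionSpaces.Torus.convect (U n t) (ψ t) x⟫ - 1 * ⟪U n t x, Torus.fracLaplacian α (ψ t) x⟫)) -
          ∫ x, (⟪U n t x, FunctionSpaces.Torus.fourierTruncate (N n) (FunctionSpaces.Torus.timeDeriv ψ t) x⟫ +
          ⟪U n t x, FunctionSpaces.Torus.convect (U n t) (fun y => FunctionSpaces.Torus.fourierTruncate (N n) (ψ t) y) x⟫ -
          1 * ⟪U n t x, Torus.fracLaplacian α (fun y => FunctionSpaces.Torus.fourierTruncate (N n) (ψ t) y) x⟫))) +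
        ∫ x, ⟪u₀ x, ψ 0 x - FunctionSpaces.Torus.fourierTruncate (N n) (ψ 0) x⟫ := by
      rw [integral_sub iΦ iΦP]
      simp_rw [inner_sub_right]
      rw [integral_sub i0 i0P]
      linarith
    rw [hsplit]
    have hE : ContinuousOn (fun t => ∫ x, ‖U n t x‖ ^ 2) (Set.Icc 0 T) :=
      (FunctionSpaces.Torus.continuousOn_integral_norm_sq_of_continuousOn_stLift (hS.continuousOn n)).mono Set.Icc_subset_Ici_self
    have iE := (hE.integrableOn_Icc (μ := volume)).mono_set Set.Ioo_subset_Icc_self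
    have hEb : ∫ t in Set.Ioo 0 T, ∫ x, ‖U n t x‖ ^ 2 ≤ T * Y := by
      have h := setIntegral_mono_on iE (integrableOn_const (C := Y) measure_Ioo_lt_top.ne) measurableSet_Ioo
        fun t ht => hYn n t ht.1.le
      rwa [setIntegral_const, Real.volume_real_Ioo_of_le hT.le, sub_zero, smul_eq_mul] at h
    have hslice : ∀ t ∈ Set.Ioo 0 T, ‖(∫ x, (⟪U n t x, FunctionSpaces.Torus.timeDeriv ψ t x⟫ +
        ⟪U n t x, FunctionSpaces.Torus.convect (U n t) (ψ t) x⟫ - 1 * ⟪U n t x, Torus.fracLaplacian α (ψ t) x⟫)) -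
        ∫ x, (⟪U n t x, FunctionSpaces.Torus.fourierTruncate (N n) (FunctionSpaces.Torus.timeDeriv ψ t) x⟫ +
        ⟪U n t x, FunctionSpaces.Torus.convect (U n t) (fun y => FunctionSpaces.Torus.fourierTruncate (N n) (ψ t) y) x⟫ -
        1 * ⟪U n t x, Torus.fracLaplacian α (fun y => FunctionSpaces.Torus.fourierTruncate (N n) (ψ t) y) x⟫)‖ ≤
        τ (N n) * (a * (∫ x, ‖U n t x‖ ^ 2) + c) := by
      intro t ht
      have ht' : t ∈ Set.Icc 0 T := ⟨ht.1.le, ht.2.le⟩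
      have hτn := hτ0 (N n)
      have h := hS.norm_sliceFunctional_trunc_sub_le hα hψ n (N n) ht.1.le
        (e₁ := K₁ * τ (N n)) (e₂ := K₂ * τ (N n)) (e₃ := K3 * τ (N n))
        (mul_nonneg hK₁0 hτn) (mul_nonneg hK₂0 hτn)
        (fun x => by rw [hτdef]; exact hK₁ _ t ht' x)
        (fun x => by rw [hτdef]; exact hK₂ _ t ht' x)
        (fun x => by
          rw [hK3def, Finset.sum_mul]
          exact Finset.sum_le_sum fun i _ => by rw [hτdef]; exact hK₃ i _ t ht' x)
      refine h.trans (le_of_eq ?_)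
      rw [hadef, hcdef]
      ring
    have ibound : IntegrableOn (fun t => τ (N n) * (a * (∫ x, ‖U n t x‖ ^ 2) + c)) (Set.Ioo 0 T) volume :=
      ((iE.const_mul _).add (integrableOn_const measure_Ioo_lt_top.ne)).const_mul _
    have h1 : ‖∫ t in Set.Ioo 0 T, ((∫ x, (⟪U n t x, FunctionSpaces.Torus.timeDeriv ψ t x⟫ +
        ⟪U n t x, FunctionSpaces.Torus.convect (U n t) (ψ t) x⟫ - 1 * ⟪U n t x, Torus.fracLaplacian α (ψ t) x⟫)) -
        ∫ x, (⟪U n t x, FunctionSpaces.Torus.fourierTruncate (N n) (FunctionSpaces.Torus.timeDeriv ψ t) x⟫ +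
        ⟪U n t x, FunctionSpaces.Torus.convect (U n t) (fun y => FunctionSpaces.Torus.fourierTruncate (N n) (ψ t) y) x⟫ -
        1 * ⟪U n t x, Torus.fracLaplacian α (fun y => FunctionSpaces.Torus.fourierTruncate (N n) (ψ t) y) x⟫))‖ ≤
        τ (N n) * (a * (T * Y) + c * T) := by
      refine (norm_integral_le_of_norm_le ibound ((ae_restrict_mem measurableSet_Ioo).mono hslice)).trans ?_
      rw [integral_const_mul, integral_add (iE.const_mul _) (integrableOn_const measure_Ioo_lt_top.ne),
        integral_const_mul, setIntegral_const, Real.volume_real_Ioo_of_le hT.le, sub_zero, smul_eq_mul]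
      refine mul_le_mul_of_nonneg_left ?_ (hτ0 _)
      have a1 := mul_le_mul_of_nonneg_left hEb ha0
      linarith
    have h2 : ‖∫ x, ⟪u₀ x, ψ 0 x - FunctionSpaces.Torus.fourierTruncate (N n) (ψ 0) x⟫‖ ≤ τ (N n) * (K₀ * ∫ x, ‖u₀ x‖) := by
      have ig : Integrable (fun x => ‖u₀ x‖ * (K₀ * τ (N n))) volume :=
        (hu₀.integrable one_le_two).norm.mul_const _
      refine (norm_integral_le_of_norm_le ig (ae_of_all _ fun x => ?_)).trans (le_of_eq ?_)
      · rw [Real.norm_eq_abs]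
        refine (abs_real_inner_le_norm _ _).trans (mul_le_mul_of_nonneg_left ?_ (norm_nonneg _))
        rw [hτdef]; exact hK₀ _ 0 ⟨le_rfl, hT.le⟩ x
      · rw [integral_mul_const]; ring
    rw [← Real.norm_eq_abs]
    refine (norm_add_le _ _).trans ?_
    rw [hMcdef]
    nlinarith [h1, h2, hτ0 (N n)]
  have hMc0 : Tendsto (fun n => τ (N n) * Mc) atTop (𝓝 0) := by
    simpa using hτlim.mul_const Mc
  exact squeeze_zero_norm (fun n => by rw [Real.norm_eq_abs]; exact hbound n) hMc0

/-- **The weak form of the fractional Navier–Stokes equations for the limit on `(0, T)`**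
(CDLDR 2018, §1, the distributional formulation with datum, and §9; RRS 2016, Thm. 4.4 Step 4 for
`α = 1`): for `α > 0` and every divergence-free space–time test field `ψ` on `[0, T)`,
`∫₀ᵀ ∫ (⟪u, ∂ₜψ⟫ + ⟪u, (u·∇)ψ⟫ - ⟪u, (-Δ)^α ψ⟫) + ∫ ⟪u₀, ψ(0)⟫ = 0`
(`E_n(ψ) → E(ψ)` by `tendsto_integral_sliceFunctional` and `E_n(ψ) → 0` by
`tendsto_weakFunctional`). [cite: ColomboDelellisDerosa2018, §1 (weak formulation) and §9] -/
theorem IsFracGalerkinScheme.weak_form_limit (hS : IsFracGalerkinScheme α u₀ N U)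
    (hα : 0 < α) (hu₀ : MemLp u₀ 2 volume)
    (hum : AEStronglyMeasurable (FunctionSpaces.Torus.stLift u) (volume.restrict (Set.Ioi 0 ×ˢ Set.univ)))
    (hu : ∀ t, 0 ≤ t → MemLp (u t) 2 volume)
    (hc : ∀ t, 0 ≤ t → ∀ k, Tendsto (fun n => mFourierCoeff (FunctionSpaces.EuclideanSpace.complexify ∘ U n t) k)
      atTop (𝓝 (mFourierCoeff (FunctionSpaces.EuclideanSpace.complexify ∘ u t) k))) (hT : 0 < T)
    (hψ : FunctionSpaces.Torus.IsSpaceTimeTest T ψ) (hdiv : FunctionSpaces.Torus.IsDivFreeTest ψ) :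
    (∫ t in Set.Ioo 0 T, ∫ x, (⟪u t x, FunctionSpaces.Torus.timeDeriv ψ t x⟫ + ⟪u t x, FunctionSpaces.Torus.convect (u t) (ψ t) x⟫ -
        1 * ⟪u t x, Torus.fracLaplacian α (ψ t) x⟫)) + ∫ x, ⟪u₀ x, ψ 0 x⟫ = 0 := by
  have h1 := (hS.tendsto_integral_sliceFunctional hα hu₀ hum hu hc hψ).add_const
    (∫ x, ⟪u₀ x, ψ 0 x⟫)
  have h2 := hS.tendsto_weakFunctional hα.le hu₀ hT hψ hdiv
  exact tendsto_nhds_unique h1 h2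

end WeakForm

end Scheme

end Literature.Analysis.FluidPDE
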